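import Literature.Analysis.FluidPDE.DistributionalL3Mild
import Literature.Analysis.FluidPDE.VeryWeakLqMildCore
import HarnessLib

/-!
# Very weak solutions with continuous `L^q` slices, `q > 2`, are mild solutions (no pressure)

Analysis/FluidPDE proofs file (theorems only: no definitions, no named facts) on the discharge
path of `Literature.Analysis.FluidPDE.chae2007_asymptoticallySelfSimilar_local` (D. Chae, Math. Ann.
338 (2007), Thm 1.5; the profile conclusion `V̄ = 0` for `3 < p < ∞`). It is the `L^q`, pressure-free
version of `DistributionalL3Mild.lean` (Fabes–Jones–Rivière 1972, Thm. 2.1, (i) ⇒ (ii);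
Lemarié-Rieusset 2016, Prop. 6.5 with Thm. 6.1): let `u` be a **very weak** solution of the unforced
Navier–Stokes system (`ν > 0`) on the open slab `(0, S) × ℝ³` — the momentum equation tested only
against smooth compactly supported **divergence-free** fields, no pressure —, jointly measurable,
weakly divergence free, with `u ∈ C((0,S); L^q)` and `sup_{0<τ<S} ‖u(τ)‖_{L^q} ≤ M`, `2 < q < ∞`.
Then for all `0 < s ≤ t < S` the two-time duality identity of Fabes–Jones–Rivière holds
(`IsMildNSSolutionBetween ν 0 u s t`, `VeryWeakLqMild.isMildNSSolutionBetween_of_veryWeak`).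

## Proof

Word for word the argument of `DistributionalL3Mild.lean`, the distributional identity being
replaced by the bound of the very weak functional `W(ψ) = ∫∫ ⟪u, ∂ₜψ⟫ + ⟪u, (u·∇)ψ⟫ + ν⟪u, Δψ⟫` on a
general test field by the size of its divergence (`VeryWeakLqMild.abs_setIntegral_veryWeakIntegrand_le`,
the core file: `|W(ψ)| ≤ K sup_t ‖div ψ(t)‖_{L^{(q/2)'}}`). For the cut-off caloric test field
`ψ_n(τ, x) = η(τ) χ_{n+1}(x) e^{ν(t−τ)Δ}φ(x)` one has `div ψ_n = η ⟪∇χ_{n+1}, e^{ν(t−τ)Δ}φ⟫ = O(1/n)`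
in `L^{(q/2)'}`, so `W(ψ_n) → 0`; on the other hand `W(ψ_n) → ∫∫ (η' ⟪u, Ψ⟫ + η ⟪u, (u·∇)Ψ⟫)`,
`Ψ(τ) = e^{ν(t−τ)Δ}φ`, by dominated convergence on the slab (dominator
`‖u‖‖Ψ‖ + ‖u‖‖DΨ‖ + ‖u‖²‖Ψ‖ + ‖u‖²‖DΨ‖`, integrable by Hölder in space, slice by slice). Fubini,
the du Bois-Reymond lemma and the continuity of the caloric pairing (`L^{q'}`-continuity of the
caloric test field by interpolation between `L¹` and `L²`, `1 < q' < 2`) conclude as there.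

## References

* E. B. Fabes, B. F. Jones, N. M. Rivière, *The initial value problem for the Navier–Stokes
  equations with data in `L^p`*, Arch. Rational Mech. Anal. 45 (1972) 222–240, Thm. 2.1.
  [FabesJonesRiviere1972]
* P. G. Lemarié-Rieusset, *The Navier–Stokes Problem in the 21st Century*, CRC Press 2016,
  Prop. 6.5, (6.13), Thm. 6.1 (pp. 130–136). [LemarieRieusset2016]
-/

noncomputable section

open _root_.MeasureTheory Set Function Filter Metric TopologicalSpace InnerProductSpace
open scoped NNReal ENNReal _root_.Topology RealInnerProductSpace Laplacian ContDiff

namespace Literature.Analysis.FluidPDE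

namespace VeryWeakLqMild

open DistributionalL3Mild

/-- Local notation for physical space `ℝ³ = EuclideanSpace ℝ (Fin 3)`. -/
local notation "ℝ³" => EuclideanSpace ℝ (Fin 3)

/-! ### Exponents -/

section Exponents

/-- For `1 < r`, the conjugate exponent `r' = r/(r−1)` exceeds `1`. [folklore] -/
theorem one_lt_conjExponent {r : ℝ} (hr : 1 < r) : 1 < Real.conjExponent r :=
  (Real.HolderConjugate.conjExponent hr).symm.lt

/-- For `2 < r`, the conjugate exponent `r' = r/(r−1)` is `< 2`. [folklore] -/
theorem conjExponent_lt_two {r : ℝ} (hr : 2 < r) : Real.conjExponent r < 2 := by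
  rw [Real.conjExponent, div_lt_iff₀ (by linarith)]
  linarith

/-- For `2 < r`, the conjugate exponent `r' = r/(r−1)` is `≤ 2`. [folklore] -/
theorem conjExponent_le_two {r : ℝ} (hr : 2 < r) : Real.conjExponent r ≤ 2 :=
  (conjExponent_lt_two hr).le

/-- `∫ ‖f‖ₑ^b = ‖f‖_{L^b}^b` for a real exponent `b > 0`. [folklore] -/
theorem lintegral_rpow_enorm_eq {α : Type*} [MeasurableSpace α] {μ : Measure α}
    {G : Type*} [NormedAddCommGroup G] (f : α → G) {b : ℝ} (hb : 0 < b) :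
    ∫⁻ x, ‖f x‖ₑ ^ b ∂μ = eLpNorm f (ENNReal.ofReal b) μ ^ b := by
  have h0 : ENNReal.ofReal b ≠ 0 := (ENNReal.ofReal_pos.2 hb).ne'
  rw [eLpNorm_eq_lintegral_rpow_enorm_toReal h0 ENNReal.ofReal_ne_top, ENNReal.toReal_ofReal hb.le,
    ← ENNReal.rpow_mul, one_div, inv_mul_cancel₀ hb.ne', ENNReal.rpow_one]

end Exponents

/-! ### Interpolation `L^q ⊆ (L¹, L²)`, `1 ≤ q ≤ 2` -/

section Interpolation

variable {α : Type*} [MeasurableSpace α] {μ : Measure α} {G : Type*} [NormedAddCommGroup G]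

/-- **`L^q` interpolation between `L¹` and `L²`**: for `1 ≤ q ≤ 2`,
`‖h‖_{L^q} ≤ ‖h‖_{L¹}^{(2−q)/q} ‖h‖_{L²}^{2(q−1)/q}` (from the tree's Lebesgue interpolation
`Literature.Analysis.FluidPDE.lintegral_rpow_interpolate`, `LerayHopfH1Test.lean`). [folklore] -/
theorem eLpNorm_le_interpolate_one_two {h : α → G} (hh : AEStronglyMeasurable h μ) {q : ℝ}
    (hq1 : 1 ≤ q) (hq2 : q ≤ 2) :
    eLpNorm h (ENNReal.ofReal q) μ ≤
      eLpNorm h 1 μ ^ ((2 - q) / q) * eLpNorm h 2 μ ^ (2 * (q - 1) / q) := by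
  have hq0 : 0 < q := by linarith
  have hint := lintegral_rpow_interpolate hh.enorm zero_lt_one one_lt_two hq1 hq2
  have e1 : eLpNorm h (ENNReal.ofReal q) μ = (∫⁻ x, ‖h x‖ₑ ^ q ∂μ) ^ (1 / q) := by
    rw [eLpNorm_eq_lintegral_rpow_enorm_toReal (ENNReal.ofReal_pos.2 hq0).ne' ENNReal.ofReal_ne_top,
      ENNReal.toReal_ofReal hq0.le]
  have e2 : eLpNorm h 1 μ = ∫⁻ x, ‖h x‖ₑ ^ (1 : ℝ) ∂μ := by
    rw [eLpNorm_one_eq_lintegral_enorm]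
    simp only [ENNReal.rpow_one]
  have e3 : eLpNorm h 2 μ = (∫⁻ x, ‖h x‖ₑ ^ (2 : ℝ) ∂μ) ^ (1 / 2 : ℝ) := by
    rw [eLpNorm_eq_lintegral_rpow_enorm_toReal two_ne_zero ENNReal.ofNat_ne_top, ENNReal.toReal_ofNat]
  rw [e1, e2, e3, ← ENNReal.rpow_mul]
  have h1 : (2 - (1 : ℝ)) = 1 := by norm_num
  rw [h1, div_one, div_one] at hint
  have f1 : (2 - q) / q = (2 - q) * (1 / q) := by ring
  have f2 : 1 / (2 : ℝ) * (2 * (q - 1) / q) = (q - 1) * (1 / q) := by ring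
  rw [f1, f2, ENNReal.rpow_mul, ENNReal.rpow_mul, ← ENNReal.mul_rpow_of_nonneg _ _ (by positivity)]
  exact ENNReal.rpow_le_rpow hint (by positivity)

end Interpolation

/-! ### The caloric test field: `L^{q'}`-continuity in time, `1 < q' ≤ 2` -/

section Caloric

variable {E : Type*} [NormedAddCommGroup E] [InnerProductSpace ℝ E] [FiniteDimensional ℝ E]
  [MeasurableSpace E] [BorelSpace E]

/-- **`L^{q}`-Hölder continuity in time of the caloric test field**, `1 ≤ q ≤ 2`: for a test field
`φ`, `0 < ν` and `σ₁ ≤ σ₂ ≤ t`,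
`‖e^{ν(t−σ₂)Δ}φ − e^{ν(t−σ₁)Δ}φ‖_{q} ≤ (2‖φ‖₁)^{(2−q)/q} ((σ₂ − σ₁) ν ‖Δφ‖₂)^{2(q−1)/q}`
(interpolation between the `L¹` contraction and the `L²`-Lipschitz bound
`eLpNorm_heatTest_sub_le`; the case `q = 3/2` is `DistributionalL3Mild.eLpNorm_heatTest_sub_threeHalves_le`).
[folklore] -/
theorem eLpNorm_heatTest_sub_interpolate_le {φ : E → E}
    (hφ : FunctionSpaces.IsTestFunctionOn (⊤ : Opens E) φ) {ν t σ₁ σ₂ : ℝ} (hν : 0 < ν)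
    (h12 : σ₁ ≤ σ₂) (h2t : σ₂ ≤ t) {q : ℝ} (hq1 : 1 ≤ q) (hq2 : q ≤ 2) :
    eLpNorm (heatTest ν φ (t - σ₂) - heatTest ν φ (t - σ₁)) (ENNReal.ofReal q) volume ≤
      (2 * eLpNorm φ 1 volume) ^ ((2 - q) / q) *
        (ENNReal.ofReal (σ₂ - σ₁) * (ENNReal.ofReal ν * eLpNorm (Δ φ) 2 volume)) ^
          (2 * (q - 1) / q) := by
  have hq0 : 0 < q := by linarith
  have hφc : HasCompactSupport φ := hφ.hasCompactSupport
  have hφ2 : ContDiff ℝ 2 φ := contDiff_infty.1 hφ.contDiff 2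
  have hφcont : Continuous φ := hφ.contDiff.continuous
  have hφ1 : MemLp φ 1 volume := hφcont.memLp_of_hasCompactSupport hφc
  have hΨ1 : ∀ σ, MemLp (heatTest ν φ (t - σ)) 1 volume := fun σ =>
    memLp_heatFlow_of_memLp hφ1 le_rfl _
  have hm : AEStronglyMeasurable (heatTest ν φ (t - σ₂) - heatTest ν φ (t - σ₁)) volume :=
    ((hΨ1 σ₂).sub (hΨ1 σ₁)).1
  refine (eLpNorm_le_interpolate_one_two hm hq1 hq2).trans ?_
  have hexp1 : 0 ≤ (2 - q) / q := div_nonneg (by linarith) hq0.le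
  have hexp2 : 0 ≤ 2 * (q - 1) / q := div_nonneg (by linarith) hq0.le
  refine mul_le_mul' (ENNReal.rpow_le_rpow ?_ hexp1) (ENNReal.rpow_le_rpow ?_ hexp2)
  · -- `L¹`: `‖Ψ₂ − Ψ₁‖₁ ≤ ‖Ψ₂‖₁ + ‖Ψ₁‖₁ ≤ 2‖φ‖₁`
    calc eLpNorm (heatTest ν φ (t - σ₂) - heatTest ν φ (t - σ₁)) 1 volume
        ≤ eLpNorm (heatTest ν φ (t - σ₂)) 1 volume + eLpNorm (heatTest ν φ (t - σ₁)) 1 volume :=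
          eLpNorm_sub_le (hΨ1 σ₂).1 (hΨ1 σ₁).1 le_rfl
      _ ≤ eLpNorm φ 1 volume + eLpNorm φ 1 volume :=
          add_le_add (eLpNorm_heatFlow_le_of_memLp hφ1 le_rfl _)
            (eLpNorm_heatFlow_le_of_memLp hφ1 le_rfl _)
      _ = 2 * eLpNorm φ 1 volume := by rw [two_mul]
  · exact eLpNorm_heatTest_sub_le hφ2 hφc hν h12 h2t

/-- The heat flow of an `L^p` function with values in a general Banach space is in `L^p` for
every real time (general-target twin of `memLp_heatFlow_of_memLp`, whose target carries an inner
product; needed for the derivative `DΨ`, valued in `ℝ³ →L[ℝ] ℝ³`). [folklore] -/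
theorem memLp_heatFlow_of_memLp_general {F : Type*} [NormedAddCommGroup F] [NormedSpace ℝ F]
    [CompleteSpace F] {g : E → F} {p : ℝ≥0∞} (hg : MemLp g p volume) (hp : 1 ≤ p) (τ : ℝ) :
    MemLp (heatFlow g τ) p volume := by
  rcases le_or_gt τ 0 with hτ | hτ
  · rwa [heatFlow_of_nonpos g hτ]
  · exact memLp_heatFlow_holds hg hp hτ.le

/-- `L^p` contraction of the heat flow for every real time, general Banach target (twin of
`eLpNorm_heatFlow_le_of_memLp`). [folklore] -/
theorem eLpNorm_heatFlow_le_of_memLp_general {F : Type*} [NormedAddCommGroup F] [NormedSpace ℝ F]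
    [CompleteSpace F] {g : E → F} {p : ℝ≥0∞} (hg : MemLp g p volume) (hp : 1 ≤ p) (τ : ℝ) :
    eLpNorm (heatFlow g τ) p volume ≤ eLpNorm g p volume := by
  rcases le_or_gt τ 0 with hτ | hτ
  · rw [heatFlow_of_nonpos g hτ]
  · exact eLpNorm_heatFlow_le_holds hg hp hτ.le

end Caloric

/-! ### Integrability on the slab by Hölder in space, slice by slice -/

section Slab

variable {S : ℝ} {G : Type*} [NormedAddCommGroup G]

/-- **Integrability of `‖u‖ᵏ ‖W‖` on the slab `(0, S) × ℝ³` from slice bounds**: if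
`∫ ‖u(τ)‖^{k a} ≤ A < ∞` and `∫ ‖W(τ)‖^{b} ≤ B < ∞` for all `τ ∈ (0, S)`, with `a, b` Hölder
conjugate, then `z ↦ ‖u(z)‖ᵏ ‖W(z)‖` is integrable on the slab (Hölder in `x` on each slice,
bounded in `τ`, finite time interval). [folklore] -/
theorem integrable_norm_pow_mul_norm_slab {u : ℝ → ℝ³ → ℝ³} {W : ℝ × ℝ³ → G} (k : ℕ)
    {a b : ℝ} (hab : a.HolderConjugate b)
    (hum : AEStronglyMeasurable (uncurry u) (volume.restrict (Ioo 0 S ×ˢ (univ : Set ℝ³))))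
    (husl : ∀ τ ∈ Ioo 0 S, AEStronglyMeasurable (u τ) volume)
    (hW : AEStronglyMeasurable W (volume.restrict (Ioo 0 S ×ˢ (univ : Set ℝ³))))
    (hWsl : ∀ τ ∈ Ioo 0 S, AEStronglyMeasurable (fun x => W (τ, x)) volume)
    {A B : ℝ≥0∞} (hA : A ≠ ⊤) (hB : B ≠ ⊤)
    (huA : ∀ τ ∈ Ioo 0 S, ∫⁻ x, ‖u τ x‖ₑ ^ ((k : ℝ) * a) ≤ A)
    (hWB : ∀ τ ∈ Ioo 0 S, ∫⁻ x, ‖W (τ, x)‖ₑ ^ b ≤ B) :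
    Integrable (fun z : ℝ × ℝ³ => ‖u z.1 z.2‖ ^ k * ‖W z‖)
      (volume.restrict (Ioo 0 S ×ˢ (univ : Set ℝ³))) := by
  have ha : 0 < a := hab.pos
  have hb : 0 < b := hab.symm.pos
  have hμ : (volume.restrict (Ioo 0 S ×ˢ (univ : Set ℝ³)) : Measure (ℝ × ℝ³)) =
      (volume.restrict (Ioo 0 S)).prod (volume : Measure ℝ³) :=
    volume_restrict_prod_univ_eq_prod (Ioo 0 S)
  have hum' : AEStronglyMeasurable (fun z : ℝ × ℝ³ => u z.1 z.2)
      (volume.restrict (Ioo 0 S ×ˢ (univ : Set ℝ³))) := hum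
  have hmeas : AEStronglyMeasurable (fun z : ℝ × ℝ³ => ‖u z.1 z.2‖ ^ k * ‖W z‖)
      (volume.restrict (Ioo 0 S ×ˢ (univ : Set ℝ³))) := (hum'.norm.pow k).mul hW.norm
  refine ⟨hmeas, ?_⟩
  rw [hasFiniteIntegral_iff_enorm]
  -- the integrand in `ℝ≥0∞`
  have hpt : ∀ z : ℝ × ℝ³, ‖‖u z.1 z.2‖ ^ k * ‖W z‖‖ₑ = ‖u z.1 z.2‖ₑ ^ (k : ℝ) * ‖W z‖ₑ := by
    intro z
    rw [enorm_mul, enorm_norm, Real.enorm_eq_ofReal (pow_nonneg (norm_nonneg _) _),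
      ENNReal.ofReal_pow (norm_nonneg _), ofReal_norm, ENNReal.rpow_natCast]
  simp_rw [hpt]
  have hFm : AEMeasurable (fun z : ℝ × ℝ³ => ‖u z.1 z.2‖ₑ ^ (k : ℝ) * ‖W z‖ₑ)
      ((volume.restrict (Ioo 0 S)).prod (volume : Measure ℝ³)) := by
    rw [← hμ]
    exact (hum'.enorm.pow_const _).mul hW.enorm
  rw [hμ, lintegral_prod _ hFm]
  -- Hölder on each slice
  have hslice : ∀ τ ∈ Ioo 0 S, ∫⁻ x, ‖u τ x‖ₑ ^ (k : ℝ) * ‖W (τ, x)‖ₑ ≤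
      A ^ (1 / a) * B ^ (1 / b) := by
    intro τ hτ
    have hf : AEMeasurable (fun x => ‖u τ x‖ₑ ^ (k : ℝ)) volume := (husl τ hτ).enorm.pow_const _
    have hg : AEMeasurable (fun x => ‖W (τ, x)‖ₑ) volume := (hWsl τ hτ).enorm
    have key := ENNReal.lintegral_mul_le_Lp_mul_Lq volume hab hf hg
    refine key.trans ?_
    have e1 : ∀ x, (‖u τ x‖ₑ ^ (k : ℝ)) ^ a = ‖u τ x‖ₑ ^ ((k : ℝ) * a) := fun x => by
      rw [← ENNReal.rpow_mul]
    simp only [e1] at key ⊢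
    gcongr
    · exact huA τ hτ
    · exact hWB τ hτ
  calc ∫⁻ τ in Ioo 0 S, ∫⁻ x, ‖u τ x‖ₑ ^ (k : ℝ) * ‖W (τ, x)‖ₑ
      ≤ ∫⁻ _ in Ioo 0 S, A ^ (1 / a) * B ^ (1 / b) := by
        refine lintegral_mono_ae ?_
        filter_upwards [ae_restrict_mem measurableSet_Ioo] with τ hτ
        exact hslice τ hτ
    _ < ⊤ := by
        rw [lintegral_const, Measure.restrict_apply_univ, Real.volume_Ioo]
        refine ENNReal.mul_lt_top (ENNReal.mul_lt_top ?_ ?_) ENNReal.ofReal_lt_top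
        · exact ENNReal.rpow_lt_top_of_nonneg (by positivity) hA
        · exact ENNReal.rpow_lt_top_of_nonneg (by positivity) hB

end Slab

/-! ### The divergence of the cut-off caloric test field -/

section Divergence

variable {E : Type*} [NormedAddCommGroup E] [InnerProductSpace ℝ E] [FiniteDimensional ℝ E]
  [MeasurableSpace E] [BorelSpace E]

/-- **Divergence of the cut-off caloric test field**: with `Ψ(τ) = e^{ν(t−τ)Δ}φ` divergence free,
`div (η(τ) χ Ψ(τ)) = η(τ) (Dχ · Ψ(τ))` (only the cut-off is seen). [folklore] -/
theorem divergence_caloricCutoffTest {ν t : ℝ} {φ : E → E} {η : ℝ → ℝ} {χ : E → ℝ}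
    (hφ : FunctionSpaces.IsTestFunctionOn (⊤ : Opens E) φ) (hdiv : VectorCalculus.IsDivFree φ)
    (hχ : ContDiff ℝ ∞ χ) (τ : ℝ) (x : E) :
    VectorCalculus.divergence (fun y => η τ • (χ y • heatTest ν φ (t - τ) y)) x =
      η τ * fderiv ℝ χ x (heatTest ν φ (t - τ) x) := by
  set Ψ : E → E := heatTest ν φ (t - τ) with hΨ
  have hφ2 : ContDiff ℝ 2 φ := contDiff_infty.1 hφ.contDiff 2
  have hφ1 : ContDiff ℝ 1 φ := contDiff_infty.1 hφ.contDiff 1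
  have hφc := hφ.hasCompactSupport
  have hΨ2 : ContDiff ℝ 2 Ψ := contDiff_heatFlow hφ2 hφc _
  have hΨ1 : ContDiff ℝ 1 Ψ := hΨ2.of_le one_le_two
  have hΨdiv : VectorCalculus.IsDivFree Ψ := isDivFree_heatFlow hφ1 hφc hdiv _
  have hχ2 : ContDiff ℝ 2 χ := hχ.of_le (by norm_cast)
  have hχ1 : ContDiff ℝ 1 χ := hχ.of_le (by norm_cast)
  have hχd : DifferentiableAt ℝ χ x := hχ1.differentiable one_ne_zero x
  have hΨd : DifferentiableAt ℝ Ψ x := hΨ1.differentiable one_ne_zero x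
  set w : E → E := fun y => χ y • Ψ y with hw
  have hw2 : ContDiff ℝ 2 w := hχ2.smul hΨ2
  have e3 : VectorCalculus.divergence w x = χ x * VectorCalculus.divergence Ψ x + ⟪Ψ x, gradient χ x⟫ :=
    divergence_smul_apply hχd hΨd
  have e4 : ⟪Ψ x, gradient χ x⟫ = fderiv ℝ χ x (Ψ x) := by
    rw [gradient, real_inner_comm, InnerProductSpace.toDual_symm_apply]
  have c3 : VectorCalculus.divergence (fun y => η τ • w y) x = η τ * VectorCalculus.divergence w x := by
    have := divergence_smul_apply (θ := fun _ : E => η τ) (u := w) (x := x)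
      (differentiableAt_const _) (hw2.differentiable (by norm_num) x)
    rw [this]
    have h0 : gradient (fun _ : E => η τ) x = 0 := by simp [gradient]
    rw [h0, inner_zero_right, add_zero]
  have eψ : (fun y => η τ • (χ y • heatTest ν φ (t - τ) y)) = fun y => η τ • w y := rfl
  rw [eψ, c3, e3, e4, hΨdiv x, mul_zero, zero_add]

end Divergence

/-! ### The tested identity `∫ (η' g + η N) dτ = 0` for very weak `L^q` solutions -/

section Core

variable {S ν : ℝ} {u : ℝ → ℝ³ → ℝ³} {φ : ℝ³ → ℝ³}

/-- From `‖v‖_{L^r} ≤ M` to `∫ ‖v‖^r ≤ M^r` (real exponent `r > 0`). [folklore] -/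
theorem integral_norm_rpow_le {v : ℝ³ → ℝ³} {r : ℝ} (hr : 0 < r)
    (hv : MemLp v (ENNReal.ofReal r) volume) {M : ℝ≥0}
    (hM : eLpNorm v (ENNReal.ofReal r) volume ≤ M) : ∫ y, ‖v y‖ ^ r ≤ (M : ℝ) ^ r := by
  have h := hv.eLpNorm_eq_integral_rpow_norm (ENNReal.ofReal_pos.2 hr).ne' ENNReal.ofReal_ne_top
  rw [ENNReal.toReal_ofReal hr.le] at h
  set I : ℝ := ∫ y, ‖v y‖ ^ r with hI
  have hI0 : 0 ≤ I := integral_nonneg fun y => by positivity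
  rw [h] at hM
  have h1 : I ^ r⁻¹ ≤ (M : ℝ) := by
    have := (ENNReal.ofReal_le_iff_le_toReal ENNReal.coe_ne_top).1 hM
    simpa using this
  calc I = (I ^ r⁻¹) ^ r := (Real.rpow_inv_rpow hI0 hr.ne').symm
    _ ≤ (M : ℝ) ^ r := Real.rpow_le_rpow (Real.rpow_nonneg hI0 _) h1 hr.le

/-- **Hölder for a scalar weight against `|u|²` on a slice**: for `2 < r`, `s = r/2`, `s'` its
conjugate, `H ∈ L^{s'}` and `w ∈ L^r`, `∫ ‖H‖ ‖w‖² ≤ ‖H‖_{L^{s'}} (∫ ‖w‖^r)^{2/r}` (variant of the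
core file's `integral_abs_mul_norm_sq_le` without compact support). [folklore] -/
theorem integral_norm_mul_norm_sq_le {r : ℝ} (hr : 2 < r) {G : Type*} [NormedAddCommGroup G]
    {H : ℝ³ → G} (hH : MemLp H (ENNReal.ofReal (Real.conjExponent (r / 2))) volume)
    {w : ℝ³ → ℝ³} (hw : MemLp w (ENNReal.ofReal r) volume) :
    ∫ x, ‖H x‖ * ‖w x‖ ^ 2 ≤
      (eLpNorm H (ENNReal.ofReal (Real.conjExponent (r / 2))) volume).toReal *
        (∫ x, ‖w x‖ ^ r) ^ (2 / r) := by
  set s : ℝ := r / 2 with hs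
  have hs1 : 1 < s := by rw [hs]; linarith
  set s' : ℝ := Real.conjExponent s with hs'
  have hss' : s.HolderConjugate s' := Real.HolderConjugate.conjExponent hs1
  have hs'pos : 0 < s' := hss'.symm.pos
  have hf : MemLp (fun x => ‖H x‖) (ENNReal.ofReal s') volume := hH.norm
  have hg : MemLp (fun x => ‖w x‖ ^ 2) (ENNReal.ofReal s) volume := by
    have h := hw.norm_rpow_div (2 : ℝ≥0∞)
    have e1 : ENNReal.ofReal r / 2 = ENNReal.ofReal s := by
      rw [hs, ENNReal.ofReal_div_of_pos two_pos, ENNReal.ofReal_ofNat]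
    rw [e1] at h
    refine h.congr_norm ?_ (Eventually.of_forall fun x => ?_)
    · exact (hw.1.norm.pow 2)
    · simp only [ENNReal.toReal_ofNat, Real.rpow_two, norm_pow, norm_norm]
  have key := integral_mul_le_Lp_mul_Lq_of_nonneg hss'.symm
    (Eventually.of_forall fun x => norm_nonneg (H x))
    (Eventually.of_forall fun x => sq_nonneg ‖w x‖) hf hg
  have e2 : (∫ x, ‖H x‖ ^ s') ^ (1 / s') =
      (eLpNorm H (ENNReal.ofReal s') volume).toReal := by
    rw [hH.eLpNorm_eq_integral_rpow_norm (by simp [hs'pos]) ENNReal.ofReal_ne_top,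
      ENNReal.toReal_ofReal (Real.rpow_nonneg (integral_nonneg fun x => by positivity) _),
      ENNReal.toReal_ofReal hs'pos.le, one_div]
  have e3 : (∫ x, (‖w x‖ ^ 2) ^ s) ^ (1 / s) = (∫ x, ‖w x‖ ^ r) ^ (2 / r) := by
    simp only [hs, norm_sq_rpow_half]
    congr 1
    field_simp
  rw [e2, e3] at key
  exact key

set_option maxHeartbeats 1600000 in
/-- **The tested identity, very weak `L^q` version.** Let `2 < r`, `0 < ν`, and let `u` be jointly
measurable on the slab `(0, S) × ℝ³` with slices `u(τ) ∈ L^r`, `‖u(τ)‖_{L^r} ≤ M` (`τ ∈ (0, S)`),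
weakly divergence free on the slab, and a very weak solution of the unforced Navier–Stokes system:
`∫∫ W(χ) = 0` for every divergence-free test field `χ` on the slab. Let `φ` be a divergence-free test
field and `0 < t < S`. Then for every smooth `η` with compact support in `(0, t)`,
`∫₀ᵗ (η'(τ) ∫⟪u(τ), e^{ν(t−τ)Δ}φ⟫ + η(τ) ∫⟪u(τ), (u(τ)·∇)e^{ν(t−τ)Δ}φ⟫) dτ = 0`:
the very weak functional of the cut-off caloric test field `η χ_{n+1} e^{ν(t−τ)Δ}φ` is `O(1/n)` by
the pressure-free bound `abs_setIntegral_veryWeakIntegrand_le`, and tends to the left-hand side by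
dominated convergence on the slab and Fubini. [cite: FabesJonesRiviere1972, Thm. 2.1 (proof, (i) ⇒ (ii)); LemarieRieusset2016, Prop. 6.5] -/
theorem integral_deriv_mul_pairing_add_eq_zero_veryWeak {t r : ℝ} {M : ℝ≥0} (hν : 0 < ν)
    (hr : 2 < r)
    (hum : AEStronglyMeasurable (uncurry u) (volume.restrict (Ioo 0 S ×ˢ (univ : Set ℝ³))))
    (hmem : ∀ τ ∈ Ioo 0 S, MemLp (u τ) (ENNReal.ofReal r) volume)
    (huM : ∀ τ ∈ Ioo 0 S, eLpNorm (u τ) (ENNReal.ofReal r) volume ≤ M)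
    (hdivsl : ∀ θ : ℝ → ℝ³ → ℝ, IsSpaceTimeTestOn (slab ℝ³ (Ioo 0 S) isOpen_Ioo) θ →
      ∫ z in Ioo 0 S ×ˢ (univ : Set ℝ³), ⟪u z.1 z.2, gradient (θ z.1) z.2⟫ = 0)
    (hweak : ∀ χ : ℝ → ℝ³ → ℝ³, IsSpaceTimeTestOn (slab ℝ³ (Ioo 0 S) isOpen_Ioo) χ →
      (∀ t, VectorCalculus.IsDivFree (χ t)) →
      ∫ z in Ioo 0 S ×ˢ (univ : Set ℝ³), veryWeakIntegrand ν u χ z = 0)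
    (hφ : FunctionSpaces.IsTestFunctionOn (⊤ : Opens ℝ³) φ) (hdiv : VectorCalculus.IsDivFree φ)
    (ht : 0 < t) (htS : t < S) {η : ℝ → ℝ} (hη : ContDiff ℝ ∞ η) (hηc : HasCompactSupport η)
    (hηt : tsupport η ⊆ Ioo 0 t) :
    ∫ τ in Ioo 0 t, ((deriv η τ * ∫ x, ⟪u τ x, heatTest ν φ (t - τ) x⟫) +
      η τ * ∫ x, ⟪u τ x, convect (u τ) (heatTest ν φ (t - τ)) x⟫) = 0 := by
  have hS : 0 < S := ht.trans htS
  set b := stdOrthonormalBasis ℝ ℝ³ with hb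
  set cE : ℝ := ((Finset.univ : Finset (Fin (Module.finrank ℝ ℝ³))).card : ℝ) with hcE
  have hcE0 : 0 ≤ cE := by positivity
  -- ### exponents
  have hr1 : 1 < r := by linarith
  have hr0 : 0 < r := by linarith
  set r' : ℝ := Real.conjExponent r with hr'
  have hrr' : r.HolderConjugate r' := Real.HolderConjugate.conjExponent hr1
  have hr'1 : 1 < r' := hrr'.symm.lt
  have hr'0 : 0 < r' := hrr'.symm.pos
  set s : ℝ := r / 2 with hs
  have hs1 : 1 < s := by rw [hs]; linarith
  have hs0 : 0 < s := by linarith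
  set s' : ℝ := Real.conjExponent s with hs'
  have hss' : s.HolderConjugate s' := Real.HolderConjugate.conjExponent hs1
  have hs'1 : 1 < s' := hss'.symm.lt
  have hs'0 : 0 < s' := hss'.symm.pos
  have h1r : (1 : ℝ≥0∞) ≤ ENNReal.ofReal r := by
    rw [← ENNReal.ofReal_one]; exact ENNReal.ofReal_le_ofReal hr1.le
  have h1r' : (1 : ℝ≥0∞) ≤ ENNReal.ofReal r' := by
    rw [← ENNReal.ofReal_one]; exact ENNReal.ofReal_le_ofReal hr'1.le
  have h1s' : (1 : ℝ≥0∞) ≤ ENNReal.ofReal s' := by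
    rw [← ENNReal.ofReal_one]; exact ENNReal.ofReal_le_ofReal hs'1.le
  haveI hRR' : (ENNReal.ofReal r).HolderConjugate (ENNReal.ofReal r') := hrr'.ennrealOfReal
  haveI hSS' : (ENNReal.ofReal s).HolderConjugate (ENNReal.ofReal s') := hss'.ennrealOfReal
  -- ### the test field and its caloric companion
  have hφi : ContDiff ℝ ∞ φ := hφ.contDiff
  have hφ2 : ContDiff ℝ 2 φ := contDiff_infty.1 hφi 2
  have hφ1 : ContDiff ℝ 1 φ := contDiff_infty.1 hφi 1
  have hφc : HasCompactSupport φ := hφ.hasCompactSupport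
  have hφc' : Continuous φ := hφi.continuous
  obtain ⟨Cφ, hCφ⟩ := hφc'.bounded_above_of_compact_support hφc
  have hDφc : Continuous (fderiv ℝ φ) := hφ1.continuous_fderiv one_ne_zero
  have hDφs : HasCompactSupport (fderiv ℝ φ) := hφc.fderiv ℝ
  obtain ⟨CD, hCD⟩ := hDφc.bounded_above_of_compact_support hDφs
  have hφp : ∀ p : ℝ≥0∞, MemLp φ p volume := fun p => hφc'.memLp_of_hasCompactSupport hφc
  have hDφp : ∀ p : ℝ≥0∞, MemLp (fderiv ℝ φ) p volume := fun p =>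
    hDφc.memLp_of_hasCompactSupport hDφs
  set Ψ : ℝ → ℝ³ → ℝ³ := fun τ => heatTest ν φ (t - τ) with hΨ
  have hΨsm : ∀ τ, ContDiff ℝ 2 (Ψ τ) := fun τ => contDiff_heatFlow hφ2 hφc _
  have hΨ1 : ∀ τ, ContDiff ℝ 1 (Ψ τ) := fun τ => (hΨsm τ).of_le one_le_two
  have hΨcs : ∀ τ, Continuous (Ψ τ) := fun τ => (hΨsm τ).continuous
  have hDΨ : ∀ τ x, fderiv ℝ (Ψ τ) x = heatFlow (fderiv ℝ φ) (ν * (t - τ)) x := fun τ x =>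
    fderiv_heatFlow hφ1 hφc _ x
  have hΨc : Continuous (uncurry Ψ) := continuous_uncurry_heatTest_sub hφc' hCφ ν t
  have hDΨc : Continuous fun q : ℝ × ℝ³ => fderiv ℝ (Ψ q.1) q.2 := by
    simp only [hDΨ]
    exact continuous_uncurry_heatTest_sub hDφc hCD ν t
  have hDΨcs : ∀ τ, Continuous fun x => fderiv ℝ (Ψ τ) x := fun τ =>
    hDΨc.comp (Continuous.prodMk_right τ)
  -- `L^p` sizes of the slices of `Ψ`, `DΨ`
  have hΨmem : ∀ (p : ℝ≥0∞), 1 ≤ p → ∀ τ, MemLp (Ψ τ) p volume := fun p hp τ =>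
    memLp_heatFlow_of_memLp (hφp p) hp _
  have hΨle : ∀ (p : ℝ≥0∞), 1 ≤ p → ∀ τ, eLpNorm (Ψ τ) p volume ≤ eLpNorm φ p volume :=
    fun p hp τ => eLpNorm_heatFlow_le_of_memLp (hφp p) hp _
  have hDΨmem : ∀ (p : ℝ≥0∞), 1 ≤ p → ∀ τ, MemLp (fun x => fderiv ℝ (Ψ τ) x) p volume := by
    intro p hp τ
    have h := memLp_heatFlow_of_memLp_general (hDφp p) hp (ν * (t - τ))
    refine h.congr_norm (hDΨcs τ).aestronglyMeasurable (Eventually.of_forall fun x => ?_)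
    rw [hDΨ]
  have hDΨle : ∀ (p : ℝ≥0∞), 1 ≤ p → ∀ τ,
      eLpNorm (fun x => fderiv ℝ (Ψ τ) x) p volume ≤ eLpNorm (fderiv ℝ φ) p volume := by
    intro p hp τ
    have h := eLpNorm_heatFlow_le_of_memLp_general (hDφp p) hp (ν * (t - τ))
    refine le_trans (le_of_eq (eLpNorm_congr_ae (Eventually.of_forall fun x => ?_))) h
    exact hDΨ τ x
  -- ### the time bump
  obtain ⟨Mη, hMη⟩ := hη.continuous.bounded_above_of_compact_support hηc
  have hMη0 : 0 ≤ Mη := (norm_nonneg _).trans (hMη 0)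
  have hηd : Continuous (deriv η) := hη.continuous_deriv (by simp)
  obtain ⟨Md, hMd⟩ := hηd.bounded_above_of_compact_support hηc.deriv
  have hMd0 : 0 ≤ Md := (norm_nonneg _).trans (hMd 0)
  have hη0 : ∀ τ, τ ∉ tsupport η → η τ = 0 := fun τ hτ => image_eq_zero_of_notMem_tsupport hτ
  have hdη0 : ∀ τ, τ ∉ tsupport η → deriv η τ = 0 := fun τ hτ => by
    by_contra h'
    exact hτ (support_deriv_subset (mem_support.2 h'))
  -- ### cut-off constants
  obtain ⟨C₁, hC₁0, hC₁⟩ := exists_norm_fderiv_cutoff_le (E := ℝ³)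
  obtain ⟨C₂, hC₂0, hC₂⟩ := exists_abs_laplacian_cutoff_le (E := ℝ³)
  have hR : ∀ n : ℕ, (0 : ℝ) < n + 1 := fun n => by positivity
  have hR1 : ∀ n : ℕ, (1 : ℝ) ≤ n + 1 := fun n => by
    have : (0 : ℝ) ≤ n := n.cast_nonneg
    linarith
  have hDχn : ∀ (n : ℕ) (x : ℝ³), ‖fderiv ℝ (cutoff ((n : ℝ) + 1)) x‖ ≤ C₁ / ((n : ℝ) + 1) :=
    fun n x => hC₁ _ (hR n) x
  have hDχ : ∀ (n : ℕ) (x : ℝ³), ‖fderiv ℝ (cutoff ((n : ℝ) + 1)) x‖ ≤ C₁ := fun n x =>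
    (hDχn n x).trans (div_le_self hC₁0 (hR1 n))
  have hΔχ : ∀ (n : ℕ) (x : ℝ³), |(Δ (cutoff ((n : ℝ) + 1) : ℝ³ → ℝ)) x| ≤ C₂ := fun n x =>
    (hC₂ _ (hR n) x).trans (div_le_self hC₂0 (by nlinarith [hR1 n]))
  -- ### the slab measure and the data on it
  set μS : Measure (ℝ × ℝ³) := (volume : Measure (ℝ × ℝ³)).restrict (Ioo 0 S ×ˢ univ) with hμS
  have hμS' : μS = (volume.restrict (Ioo 0 S)).prod (volume : Measure ℝ³) :=
    volume_restrict_prod_univ_eq_prod (Ioo 0 S)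
  have hum' : AEStronglyMeasurable (fun z : ℝ × ℝ³ => u z.1 z.2) μS := hum
  have husl : ∀ τ ∈ Ioo 0 S, AEStronglyMeasurable (u τ) volume := fun τ hτ => (hmem τ hτ).1
  -- slice sizes of `u`: `∫ ‖u(τ)‖^r ≤ M^r`
  have hur_slice : ∀ τ ∈ Ioo 0 S, ∫⁻ x, ‖u τ x‖ₑ ^ r ≤ (M : ℝ≥0∞) ^ r := by
    intro τ hτ
    rw [lintegral_rpow_enorm_eq (u τ) hr0]
    exact ENNReal.rpow_le_rpow (huM τ hτ) hr0.le
  have hArtop : ((M : ℝ≥0∞) ^ r) ≠ ⊤ := ENNReal.rpow_ne_top_of_nonneg hr0.le ENNReal.coe_ne_top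
  -- `∫∫ ‖u‖^r < ∞` on the slab
  have hur : ∫⁻ z in Ioo 0 S ×ˢ (univ : Set ℝ³), ‖uncurry u z‖ₑ ^ r < ⊤ := by
    have hmeas : AEMeasurable (fun z : ℝ × ℝ³ => ‖u z.1 z.2‖ₑ ^ r)
        ((volume.restrict (Ioo 0 S)).prod (volume : Measure ℝ³)) := by
      rw [← hμS']; exact hum'.enorm.pow_const _
    change ∫⁻ z, ‖u z.1 z.2‖ₑ ^ r ∂μS < ⊤
    rw [hμS', lintegral_prod _ hmeas]
    calc ∫⁻ τ in Ioo 0 S, ∫⁻ x, ‖u τ x‖ₑ ^ r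
        ≤ ∫⁻ _ in Ioo 0 S, (M : ℝ≥0∞) ^ r := by
          refine lintegral_mono_ae ?_
          filter_upwards [ae_restrict_mem measurableSet_Ioo] with τ hτ
          exact hur_slice τ hτ
      _ < ⊤ := by
          rw [lintegral_const, Measure.restrict_apply_univ, Real.volume_Ioo]
          exact ENNReal.mul_lt_top (lt_top_iff_ne_top.2 hArtop) ENNReal.ofReal_lt_top
  have huLr : MemLp (uncurry u) (ENNReal.ofReal r) μS := by
    refine ⟨hum, ?_⟩
    rw [eLpNorm_eq_lintegral_rpow_enorm_toReal (ENNReal.ofReal_pos.2 hr0).ne' ENNReal.ofReal_ne_top,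
      ENNReal.toReal_ofReal hr0.le]
    exact ENNReal.rpow_lt_top_of_nonneg (by positivity) hur.ne
  have hu1 : LocallyIntegrableOn (uncurry u)
      ((slab ℝ³ (Ioo 0 S) isOpen_Ioo : Opens (ℝ × ℝ³)) : Set (ℝ × ℝ³)) volume :=
    locallyIntegrableOn_slab_of_memLp huLr h1r
  have hu2 : LocallyIntegrableOn (fun z => ‖uncurry u z‖ ^ 2)
      ((slab ℝ³ (Ioo 0 S) isOpen_Ioo : Opens (ℝ × ℝ³)) : Set (ℝ × ℝ³)) volume := by
    have h := huLr.norm_rpow_div (2 : ℝ≥0∞)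
    have e1 : ENNReal.ofReal r / 2 = ENNReal.ofReal s := by
      rw [hs, ENNReal.ofReal_div_of_pos two_pos, ENNReal.ofReal_ofNat]
    rw [e1] at h
    have h' : MemLp (fun z => ‖uncurry u z‖ ^ 2) (ENNReal.ofReal s) μS := by
      refine h.congr_norm (huLr.1.norm.pow 2) (Eventually.of_forall fun z => ?_)
      simp only [ENNReal.toReal_ofNat, Real.rpow_two, norm_pow, norm_norm]
    refine locallyIntegrableOn_slab_of_memLp h' ?_
    rw [← ENNReal.ofReal_one]; exact ENNReal.ofReal_le_ofReal hs1.le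
  -- ### the pressure-free bound of the very weak functional
  have hM₂ : ∀ τ ∈ Ioo 0 S, (∫ x, ‖u τ x‖ ^ r) ^ (2 / r) ≤ ((M : ℝ) ^ r) ^ (2 / r) := fun τ hτ =>
    Real.rpow_le_rpow (integral_nonneg fun x => by positivity)
      (integral_norm_rpow_le hr0 (hmem τ hτ) (huM τ hτ)) (by positivity)
  obtain ⟨K, hK0, hK⟩ := abs_setIntegral_veryWeakIntegrand_le (ν := ν) hS hr hu1 hu2 hum hur hmem
    (by positivity) hM₂ hdivsl hweak
  -- ### the integrands
  set A : ℝ × ℝ³ → ℝ := fun z => ⟪u z.1 z.2, Ψ z.1 z.2⟫ with hA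
  set N : ℝ × ℝ³ → ℝ := fun z => ⟪u z.1 z.2, convect (u z.1) (Ψ z.1) z.2⟫ with hN
  set F : ℕ → ℝ × ℝ³ → ℝ := fun n z =>
    deriv η z.1 * (cutoff ((n : ℝ) + 1) z.2 * A z) +
      η z.1 * (cutoff ((n : ℝ) + 1) z.2 * N z +
        fderiv ℝ (cutoff ((n : ℝ) + 1)) z.2 (u z.1 z.2) * A z +
        ν * (2 * ∑ i, fderiv ℝ (cutoff ((n : ℝ) + 1)) z.2 (b i) *
          ⟪u z.1 z.2, fderiv ℝ (Ψ z.1) z.2 (b i)⟫ +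
          (Δ (cutoff ((n : ℝ) + 1) : ℝ³ → ℝ)) z.2 * A z)) with hF
  set Fl : ℝ × ℝ³ → ℝ := fun z => deriv η z.1 * A z + η z.1 * N z with hFl
  -- ### (i) the very weak functional of the cut-off caloric test, and its size
  set ψn : ℕ → ℝ → ℝ³ → ℝ³ := fun n τ x =>
    η τ • (cutoff ((n : ℝ) + 1) x • heatTest ν φ (t - τ) x) with hψn
  have hψt : ∀ n : ℕ, IsSpaceTimeTestOn (slab ℝ³ (Ioo 0 S) isOpen_Ioo) (ψn n) := fun n =>
    isSpaceTimeTestOn_caloricCutoffTest hφ hν htS hη hηc hηt (contDiff_cutoff ((n : ℝ) + 1))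
      (hasCompactSupport_cutoff (hR n))
  have hFeq : ∀ (n : ℕ) (z : ℝ × ℝ³), veryWeakIntegrand ν u (ψn n) z = F n z := by
    intro n z
    have e := veryWeakIntegrand_caloricCutoffTest hφ hdiv hν hη hηt (contDiff_cutoff ((n : ℝ) + 1))
      u (fun _ _ => (0 : ℝ)) z.1 z.2
    simp only [zero_mul, add_zero] at e
    rw [veryWeakIntegrand_apply]
    exact e
  -- the size of `div ψn`
  set Gn : ℕ → ℝ := fun n => Mη * (C₁ / ((n : ℝ) + 1)) *
    (eLpNorm φ (ENNReal.ofReal s') volume).toReal with hGn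
  have hGn0 : ∀ n, 0 ≤ Gn n := fun n => by positivity
  have hdivψ : ∀ (n : ℕ) (τ : ℝ), eLpNorm (fun x => VectorCalculus.divergence (ψn n τ) x)
      (ENNReal.ofReal s') volume ≤ ENNReal.ofReal (Gn n) := by
    intro n τ
    have hpt : ∀ x, VectorCalculus.divergence (ψn n τ) x =
        η τ * fderiv ℝ (cutoff ((n : ℝ) + 1)) x (Ψ τ x) := fun x =>
      divergence_caloricCutoffTest hφ hdiv (contDiff_cutoff ((n : ℝ) + 1)) τ x
    have hbound : ∀ᵐ x ∂(volume : Measure ℝ³), ‖VectorCalculus.divergence (ψn n τ) x‖ ≤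
        (Mη * (C₁ / ((n : ℝ) + 1))) * ‖Ψ τ x‖ := by
      refine Eventually.of_forall fun x => ?_
      rw [hpt x, norm_mul]
      have h1 : ‖η τ‖ ≤ Mη := hMη τ
      have h2 : ‖fderiv ℝ (cutoff ((n : ℝ) + 1)) x (Ψ τ x)‖ ≤ C₁ / ((n : ℝ) + 1) * ‖Ψ τ x‖ :=
        (ContinuousLinearMap.le_opNorm _ _).trans
          (mul_le_mul_of_nonneg_right (hDχn n x) (norm_nonneg _))
      calc ‖η τ‖ * ‖fderiv ℝ (cutoff ((n : ℝ) + 1)) x (Ψ τ x)‖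
          ≤ Mη * (C₁ / ((n : ℝ) + 1) * ‖Ψ τ x‖) :=
            mul_le_mul h1 h2 (norm_nonneg _) hMη0
        _ = Mη * (C₁ / ((n : ℝ) + 1)) * ‖Ψ τ x‖ := by ring
    have key := eLpNorm_le_mul_eLpNorm_of_ae_le_mul hbound (ENNReal.ofReal s')
    refine key.trans ?_
    have hφfin : eLpNorm φ (ENNReal.ofReal s') volume ≠ ⊤ := (hφp _).2.ne
    calc ENNReal.ofReal (Mη * (C₁ / ((n : ℝ) + 1))) * eLpNorm (Ψ τ) (ENNReal.ofReal s') volume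
        ≤ ENNReal.ofReal (Mη * (C₁ / ((n : ℝ) + 1))) * eLpNorm φ (ENNReal.ofReal s') volume :=
          mul_le_mul' le_rfl (hΨle _ h1s' τ)
      _ = ENNReal.ofReal (Gn n) := by
          simp only [hGn]
          rw [ENNReal.ofReal_mul (by positivity : (0 : ℝ) ≤ Mη * (C₁ / ((n : ℝ) + 1))),
            ENNReal.ofReal_toReal hφfin]
  have hident : ∀ n : ℕ, |∫ z, F n z ∂μS| ≤ K * Gn n := by
    intro n
    have h := hK (hψt n) (hGn0 n) (hdivψ n)
    have e : ∫ z in Ioo 0 S ×ˢ (univ : Set ℝ³), veryWeakIntegrand ν u (ψn n) z = ∫ z, F n z ∂μS :=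
      integral_congr_ae (Eventually.of_forall fun z => hFeq n z)
    rw [e] at h
    exact h
  have hGlim : Tendsto (fun n : ℕ => K * Gn n) atTop (𝓝 0) := by
    have h1 : Tendsto (fun n : ℕ => C₁ / ((n : ℝ) + 1)) atTop (𝓝 0) :=
      tendsto_const_nhds.div_atTop (tendsto_natCast_atTop_atTop.atTop_add tendsto_const_nhds)
    have h2 : Tendsto (fun n : ℕ => Gn n) atTop (𝓝 0) := by
      have := (h1.const_mul Mη).mul_const (eLpNorm φ (ENNReal.ofReal s') volume).toReal
      simpa [hGn] using this
    simpa using h2.const_mul K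
  have h0 : Tendsto (fun n : ℕ => ∫ z, F n z ∂μS) atTop (𝓝 0) := by
    refine squeeze_zero_norm (fun n => ?_) hGlim
    rw [Real.norm_eq_abs]
    exact hident n
  -- ### (ii) measurability of the integrands
  have hχc : ∀ n : ℕ, Continuous (cutoff ((n : ℝ) + 1) : ℝ³ → ℝ) := fun n =>
    (contDiff_cutoff (n := 0) _).continuous
  have hDχc : ∀ n : ℕ, Continuous (fderiv ℝ (cutoff ((n : ℝ) + 1) : ℝ³ → ℝ)) := fun n =>
    (contDiff_cutoff (n := 1) _).continuous_fderiv one_ne_zero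
  have hΔχc : ∀ n : ℕ, Continuous (Δ (cutoff ((n : ℝ) + 1) : ℝ³ → ℝ)) := fun n =>
    FluidPDE.continuous_laplacian (contDiff_cutoff (n := 2) _)
  have hAm : AEStronglyMeasurable A μS := hum'.inner hΨc.aestronglyMeasurable
  have hNm : AEStronglyMeasurable N μS :=
    hum'.inner (aestronglyMeasurable_clm_apply hDΨc.aestronglyMeasurable hum')
  have hη1m : AEStronglyMeasurable (fun z : ℝ × ℝ³ => η z.1) μS :=
    (hη.continuous.comp continuous_fst).aestronglyMeasurable
  have hdη1m : AEStronglyMeasurable (fun z : ℝ × ℝ³ => deriv η z.1) μS :=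
    (hηd.comp continuous_fst).aestronglyMeasurable
  have hFm : ∀ n, AEStronglyMeasurable (F n) μS := by
    intro n
    have m1 : AEStronglyMeasurable (fun z : ℝ × ℝ³ => cutoff ((n : ℝ) + 1) z.2) μS :=
      ((hχc n).comp continuous_snd).aestronglyMeasurable
    have m2 : AEStronglyMeasurable (fun z : ℝ × ℝ³ => fderiv ℝ (cutoff ((n : ℝ) + 1)) z.2) μS :=
      ((hDχc n).comp continuous_snd).aestronglyMeasurable
    have m3 : AEStronglyMeasurable (fun z : ℝ × ℝ³ => (Δ (cutoff ((n : ℝ) + 1) : ℝ³ → ℝ)) z.2) μS :=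
      ((hΔχc n).comp continuous_snd).aestronglyMeasurable
    have m4 : AEStronglyMeasurable (fun z : ℝ × ℝ³ => fderiv ℝ (cutoff ((n : ℝ) + 1)) z.2 (u z.1 z.2)) μS :=
      aestronglyMeasurable_clm_apply m2 hum'
    have m5 : ∀ i, AEStronglyMeasurable (fun z : ℝ × ℝ³ =>
        fderiv ℝ (cutoff ((n : ℝ) + 1)) z.2 (b i) * ⟪u z.1 z.2, fderiv ℝ (Ψ z.1) z.2 (b i)⟫) μS :=
      fun i => (m2.apply_continuousLinearMap (b i)).mul
        (hum'.inner (hDΨc.aestronglyMeasurable.apply_continuousLinearMap (b i)))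
    have m6 : AEStronglyMeasurable (fun z : ℝ × ℝ³ =>
        ∑ i, fderiv ℝ (cutoff ((n : ℝ) + 1)) z.2 (b i) * ⟪u z.1 z.2, fderiv ℝ (Ψ z.1) z.2 (b i)⟫) μS := by
      exact Finset.aestronglyMeasurable_fun_sum _ fun i _ => m5 i
    exact (hdη1m.mul (m1.mul hAm)).add (hη1m.mul (((m1.mul hNm).add (m4.mul hAm)).add
      (aestronglyMeasurable_const.mul ((aestronglyMeasurable_const.mul m6).add (m3.mul hAm)))))
  -- ### (iii) the dominating function: `‖u‖‖Ψ‖, ‖u‖‖DΨ‖, ‖u‖²‖Ψ‖, ‖u‖²‖DΨ‖` are integrable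
  have hΨW : AEStronglyMeasurable (fun z : ℝ × ℝ³ => Ψ z.1 z.2) μS := hΨc.aestronglyMeasurable
  have hDΨW : AEStronglyMeasurable (fun z : ℝ × ℝ³ => fderiv ℝ (Ψ z.1) z.2) μS :=
    hDΨc.aestronglyMeasurable
  have hφtop : ∀ {q : ℝ}, 0 < q → eLpNorm φ (ENNReal.ofReal q) volume ^ q ≠ ⊤ := fun hq =>
    ENNReal.rpow_ne_top_of_nonneg hq.le (hφp _).2.ne
  have hDφtop : ∀ {q : ℝ}, 0 < q → eLpNorm (fderiv ℝ φ) (ENNReal.ofReal q) volume ^ q ≠ ⊤ :=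
    fun hq => ENNReal.rpow_ne_top_of_nonneg hq.le (hDφp _).2.ne
  have hΨB : ∀ {q : ℝ}, 1 < q → ∀ τ ∈ Ioo 0 S,
      ∫⁻ x, ‖Ψ τ x‖ₑ ^ q ≤ eLpNorm φ (ENNReal.ofReal q) volume ^ q := by
    intro q hq τ _
    have hq0 : 0 < q := by linarith
    have h1q : (1 : ℝ≥0∞) ≤ ENNReal.ofReal q := by
      rw [← ENNReal.ofReal_one]; exact ENNReal.ofReal_le_ofReal hq.le
    rw [lintegral_rpow_enorm_eq (Ψ τ) hq0]
    exact ENNReal.rpow_le_rpow (hΨle _ h1q τ) hq0.le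
  have hDΨB : ∀ {q : ℝ}, 1 < q → ∀ τ ∈ Ioo 0 S,
      ∫⁻ x, ‖fderiv ℝ (Ψ τ) x‖ₑ ^ q ≤ eLpNorm (fderiv ℝ φ) (ENNReal.ofReal q) volume ^ q := by
    intro q hq τ _
    have hq0 : 0 < q := by linarith
    have h1q : (1 : ℝ≥0∞) ≤ ENNReal.ofReal q := by
      rw [← ENNReal.ofReal_one]; exact ENNReal.ofReal_le_ofReal hq.le
    rw [lintegral_rpow_enorm_eq (fun x => fderiv ℝ (Ψ τ) x) hq0]
    exact ENNReal.rpow_le_rpow (hDΨle _ h1q τ) hq0.le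
  have hu1A : ∀ τ ∈ Ioo 0 S, ∫⁻ x, ‖u τ x‖ₑ ^ (((1 : ℕ) : ℝ) * r) ≤ (M : ℝ≥0∞) ^ r := by
    intro τ hτ
    rw [show (((1 : ℕ) : ℝ) * r) = r by push_cast; ring]
    exact hur_slice τ hτ
  have hu2A : ∀ τ ∈ Ioo 0 S, ∫⁻ x, ‖u τ x‖ₑ ^ (((2 : ℕ) : ℝ) * s) ≤ (M : ℝ≥0∞) ^ r := by
    intro τ hτ
    rw [show (((2 : ℕ) : ℝ) * s) = r by rw [hs]; push_cast; ring]
    exact hur_slice τ hτ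
  have I₁ : Integrable (fun z : ℝ × ℝ³ => ‖u z.1 z.2‖ ^ 1 * ‖Ψ z.1 z.2‖) μS :=
    integrable_norm_pow_mul_norm_slab (W := fun z : ℝ × ℝ³ => Ψ z.1 z.2) 1 hrr' hum husl hΨW
      (fun τ _ => (hΨcs τ).aestronglyMeasurable) hArtop (hφtop hr'0) hu1A (hΨB hr'1)
  have I₂ : Integrable (fun z : ℝ × ℝ³ => ‖u z.1 z.2‖ ^ 1 * ‖fderiv ℝ (Ψ z.1) z.2‖) μS :=
    integrable_norm_pow_mul_norm_slab (W := fun z : ℝ × ℝ³ => fderiv ℝ (Ψ z.1) z.2) 1 hrr' hum husl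
      hDΨW (fun τ _ => (hDΨcs τ).aestronglyMeasurable) hArtop (hDφtop hr'0) hu1A (hDΨB hr'1)
  have I₃ : Integrable (fun z : ℝ × ℝ³ => ‖u z.1 z.2‖ ^ 2 * ‖Ψ z.1 z.2‖) μS :=
    integrable_norm_pow_mul_norm_slab (W := fun z : ℝ × ℝ³ => Ψ z.1 z.2) 2 hss' hum husl hΨW
      (fun τ _ => (hΨcs τ).aestronglyMeasurable) hArtop (hφtop hs'0) hu2A (hΨB hs'1)
  have I₄ : Integrable (fun z : ℝ × ℝ³ => ‖u z.1 z.2‖ ^ 2 * ‖fderiv ℝ (Ψ z.1) z.2‖) μS :=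
    integrable_norm_pow_mul_norm_slab (W := fun z : ℝ × ℝ³ => fderiv ℝ (Ψ z.1) z.2) 2 hss' hum husl
      hDΨW (fun τ _ => (hDΨcs τ).aestronglyMeasurable) hArtop (hDφtop hs'0) hu2A (hDΨB hs'1)
  set K₁ : ℝ := Md + Mη * (ν * C₂) with hK₁
  set K₂ : ℝ := Mη * (ν * (2 * (cE * C₁))) with hK₂
  set K₃ : ℝ := Mη * C₁ with hK₃
  set K₄ : ℝ := Mη with hK₄
  set Gd : ℝ × ℝ³ → ℝ := fun z => K₁ * (‖u z.1 z.2‖ ^ 1 * ‖Ψ z.1 z.2‖) +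
    K₂ * (‖u z.1 z.2‖ ^ 1 * ‖fderiv ℝ (Ψ z.1) z.2‖) +
    K₃ * (‖u z.1 z.2‖ ^ 2 * ‖Ψ z.1 z.2‖) + K₄ * (‖u z.1 z.2‖ ^ 2 * ‖fderiv ℝ (Ψ z.1) z.2‖) with hGd
  have hGi : Integrable Gd μS :=
    (((I₁.const_mul K₁).add (I₂.const_mul K₂)).add (I₃.const_mul K₃)).add (I₄.const_mul K₄)
  -- the elementary estimates at a point
  have hptA : ∀ z : ℝ × ℝ³, |A z| ≤ ‖u z.1 z.2‖ ^ 1 * ‖Ψ z.1 z.2‖ := fun z => by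
    rw [pow_one]; exact abs_real_inner_le_norm _ _
  have hptN : ∀ z : ℝ × ℝ³, |N z| ≤ ‖u z.1 z.2‖ ^ 2 * ‖fderiv ℝ (Ψ z.1) z.2‖ := by
    intro z
    calc |N z| ≤ ‖u z.1 z.2‖ * ‖fderiv ℝ (Ψ z.1) z.2 (u z.1 z.2)‖ := abs_real_inner_le_norm _ _
      _ ≤ ‖u z.1 z.2‖ * (‖fderiv ℝ (Ψ z.1) z.2‖ * ‖u z.1 z.2‖) :=
          mul_le_mul_of_nonneg_left (ContinuousLinearMap.le_opNorm _ _) (norm_nonneg _)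
      _ = ‖u z.1 z.2‖ ^ 2 * ‖fderiv ℝ (Ψ z.1) z.2‖ := by ring
  have hbound : ∀ n z, ‖F n z‖ ≤ Gd z := by
    intro n z
    set a : ℝ := ‖u z.1 z.2‖ with ha
    set ps : ℝ := ‖Ψ z.1 z.2‖ with hps
    set d : ℝ := ‖fderiv ℝ (Ψ z.1) z.2‖ with hd
    have ha0 : 0 ≤ a := norm_nonneg _
    have hps0 : 0 ≤ ps := norm_nonneg _
    have hd0 : 0 ≤ d := norm_nonneg _
    have b4 : |cutoff ((n : ℝ) + 1) z.2| ≤ 1 := abs_cutoff_le_one _ _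
    have b5 : ‖fderiv ℝ (cutoff ((n : ℝ) + 1)) z.2‖ ≤ C₁ := hDχ n z.2
    have b6 : |(Δ (cutoff ((n : ℝ) + 1) : ℝ³ → ℝ)) z.2| ≤ C₂ := hΔχ n z.2
    have hlin : ∀ v : ℝ³, |fderiv ℝ (cutoff ((n : ℝ) + 1)) z.2 v| ≤ C₁ * ‖v‖ := fun v => by
      rw [← Real.norm_eq_abs]
      exact (ContinuousLinearMap.le_opNorm _ _).trans (mul_le_mul_of_nonneg_right b5 (norm_nonneg _))
    have hηz : |η z.1| ≤ Mη := by simpa [Real.norm_eq_abs] using hMη z.1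
    have hdηz : |deriv η z.1| ≤ Md := by simpa [Real.norm_eq_abs] using hMd z.1
    have amA : |A z| ≤ a ^ 1 * ps := hptA z
    have amN : |N z| ≤ a ^ 2 * d := hptN z
    have e4 : |A z| ≤ a * ps := by simpa [pow_one] using amA
    -- term by term
    have hT0 : |deriv η z.1 * (cutoff ((n : ℝ) + 1) z.2 * A z)| ≤ Md * (1 * (a ^ 1 * ps)) := by
      rw [abs_mul, abs_mul]
      exact mul_le_mul hdηz (mul_le_mul b4 amA (abs_nonneg _) zero_le_one) (by positivity) hMd0
    have hT1 : |cutoff ((n : ℝ) + 1) z.2 * N z| ≤ 1 * (a ^ 2 * d) := by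
      rw [abs_mul]
      exact mul_le_mul b4 amN (abs_nonneg _) zero_le_one
    have hT2 : |fderiv ℝ (cutoff ((n : ℝ) + 1)) z.2 (u z.1 z.2) * A z| ≤ C₁ * (a ^ 2 * ps) := by
      rw [abs_mul]
      calc |fderiv ℝ (cutoff ((n : ℝ) + 1)) z.2 (u z.1 z.2)| * |A z|
          ≤ (C₁ * a) * (a * ps) :=
            mul_le_mul (hlin _) e4 (abs_nonneg _) (by positivity)
        _ = C₁ * (a ^ 2 * ps) := by ring
    have e5 : ∀ i, |fderiv ℝ (cutoff ((n : ℝ) + 1)) z.2 (b i) *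
        ⟪u z.1 z.2, fderiv ℝ (Ψ z.1) z.2 (b i)⟫| ≤ C₁ * (a * d) := fun i => by
      rw [abs_mul]
      refine mul_le_mul ?_ ?_ (abs_nonneg _) hC₁0
      · simpa [b.orthonormal.1 i] using hlin (b i)
      · refine (abs_real_inner_le_norm _ _).trans (mul_le_mul_of_nonneg_left ?_ (norm_nonneg _))
        simpa [b.orthonormal.1 i] using ContinuousLinearMap.le_opNorm (fderiv ℝ (Ψ z.1) z.2) (b i)
    have e6 : |∑ i, fderiv ℝ (cutoff ((n : ℝ) + 1)) z.2 (b i) *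
        ⟪u z.1 z.2, fderiv ℝ (Ψ z.1) z.2 (b i)⟫| ≤ cE * (C₁ * (a * d)) := by
      refine (Finset.abs_sum_le_sum_abs _ _).trans ?_
      refine (Finset.sum_le_sum fun i _ => e5 i).trans ?_
      rw [Finset.sum_const, nsmul_eq_mul]
    have hT3 : |ν * (2 * ∑ i, fderiv ℝ (cutoff ((n : ℝ) + 1)) z.2 (b i) *
        ⟪u z.1 z.2, fderiv ℝ (Ψ z.1) z.2 (b i)⟫ +
        (Δ (cutoff ((n : ℝ) + 1) : ℝ³ → ℝ)) z.2 * A z)| ≤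
        ν * (2 * (cE * (C₁ * (a * d))) + C₂ * (a * ps)) := by
      rw [abs_mul, abs_of_pos hν]
      refine mul_le_mul_of_nonneg_left ((abs_add_le _ _).trans (add_le_add ?_ ?_)) hν.le
      · rw [abs_mul, abs_two]
        exact mul_le_mul_of_nonneg_left e6 zero_le_two
      · rw [abs_mul]
        exact mul_le_mul b6 e4 (abs_nonneg _) hC₂0
    have hTη : |η z.1 * (cutoff ((n : ℝ) + 1) z.2 * N z +
        fderiv ℝ (cutoff ((n : ℝ) + 1)) z.2 (u z.1 z.2) * A z +
        ν * (2 * ∑ i, fderiv ℝ (cutoff ((n : ℝ) + 1)) z.2 (b i) *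
          ⟪u z.1 z.2, fderiv ℝ (Ψ z.1) z.2 (b i)⟫ +
          (Δ (cutoff ((n : ℝ) + 1) : ℝ³ → ℝ)) z.2 * A z))| ≤
        Mη * (1 * (a ^ 2 * d) + C₁ * (a ^ 2 * ps) +
          ν * (2 * (cE * (C₁ * (a * d))) + C₂ * (a * ps))) := by
      rw [abs_mul]
      refine mul_le_mul hηz ?_ (abs_nonneg _) hMη0
      exact (abs_add_le _ _).trans
        (add_le_add ((abs_add_le _ _).trans (add_le_add hT1 hT2)) hT3)
    rw [Real.norm_eq_abs]
    calc |F n z| ≤ |deriv η z.1 * (cutoff ((n : ℝ) + 1) z.2 * A z)| +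
          |η z.1 * (cutoff ((n : ℝ) + 1) z.2 * N z +
            fderiv ℝ (cutoff ((n : ℝ) + 1)) z.2 (u z.1 z.2) * A z +
            ν * (2 * ∑ i, fderiv ℝ (cutoff ((n : ℝ) + 1)) z.2 (b i) *
              ⟪u z.1 z.2, fderiv ℝ (Ψ z.1) z.2 (b i)⟫ +
              (Δ (cutoff ((n : ℝ) + 1) : ℝ³ → ℝ)) z.2 * A z))| := abs_add_le _ _
      _ ≤ Md * (1 * (a ^ 1 * ps)) +
          Mη * (1 * (a ^ 2 * d) + C₁ * (a ^ 2 * ps) +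
            ν * (2 * (cE * (C₁ * (a * d))) + C₂ * (a * ps))) := add_le_add hT0 hTη
      _ = Gd z := by
          simp only [hGd, hK₁, hK₂, hK₃, hK₄, ha, hps, hd]
          ring
  -- ### (iv) the pointwise limit
  have hlim : ∀ z : ℝ × ℝ³, Tendsto (fun n => F n z) atTop (𝓝 (Fl z)) := by
    intro z
    refine tendsto_const_nhds.congr' ?_
    have hev : ∀ᶠ n : ℕ in atTop, ‖z.2‖ < (n : ℝ) + 1 := by
      filter_upwards [(tendsto_natCast_atTop_atTop (R := ℝ)).eventually_gt_atTop ‖z.2‖] with n hn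
      exact hn.trans (lt_add_one _)
    filter_upwards [hev] with n hn
    have c1 : cutoff ((n : ℝ) + 1) z.2 = 1 := cutoff_eq_one (hR n) hn.le
    have c2 : fderiv ℝ (cutoff ((n : ℝ) + 1)) z.2 = 0 := fderiv_cutoff_eq_zero (hR n) hn
    have c3 : (Δ (cutoff ((n : ℝ) + 1) : ℝ³ → ℝ)) z.2 = 0 := laplacian_cutoff_eq_zero (hR n) hn
    simp [hF, hFl, c1, c2, c3]
  -- ### (v) dominated convergence on the slab: `∫ Fl = 0`
  have hFl0 : ∫ z, Fl z ∂μS = 0 := by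
    have h := tendsto_integral_filter_of_dominated_convergence Gd (Eventually.of_forall hFm)
      (Eventually.of_forall fun n => Eventually.of_forall (hbound n)) hGi (Eventually.of_forall hlim)
    exact tendsto_nhds_unique h h0
  -- ### (vi) Fubini and the slice integrals
  have hFlb : ∀ z, ‖Fl z‖ ≤ Gd z := fun z =>
    le_of_tendsto' ((hlim z).norm) (fun n => hbound n z)
  have hFli : Integrable Fl μS :=
    Integrable.mono' hGi ((hdη1m.mul hAm).add (hη1m.mul hNm)) (Eventually.of_forall hFlb)
  have hFli' : Integrable Fl ((volume.restrict (Ioo 0 S)).prod (volume : Measure ℝ³)) := by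
    rw [← hμS']; exact hFli
  have hprod : ∫ τ in Ioo 0 S, ∫ x, Fl (τ, x) = 0 := by
    rw [← integral_prod Fl hFli', ← hμS', hFl0]
  -- the slice pairings are honest integrals
  have hu2mem : ∀ τ ∈ Ioo 0 S, MemLp (fun x => ‖u τ x‖ ^ 2) (ENNReal.ofReal s) volume := by
    intro τ hτ
    have h := (hmem τ hτ).norm_rpow_div (2 : ℝ≥0∞)
    have e1 : ENNReal.ofReal r / 2 = ENNReal.ofReal s := by
      rw [hs, ENNReal.ofReal_div_of_pos two_pos, ENNReal.ofReal_ofNat]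
    rw [e1] at h
    refine h.congr_norm ((hmem τ hτ).1.norm.pow 2) (Eventually.of_forall fun x => ?_)
    simp only [ENNReal.toReal_ofNat, Real.rpow_two, norm_pow, norm_norm]
  have iA : ∀ τ ∈ Ioo 0 S, Integrable (fun x => ⟪u τ x, Ψ τ x⟫) (volume : Measure ℝ³) :=
    fun τ hτ => integrable_inner_of_memLp_conj (hmem τ hτ) (hΨmem _ h1r' τ)
  have iN : ∀ τ ∈ Ioo 0 S, Integrable (fun x => ⟪u τ x, convect (u τ) (Ψ τ) x⟫)
      (volume : Measure ℝ³) := by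
    intro τ hτ
    have h1 : MemLp (fun x => ‖fderiv ℝ (Ψ τ) x‖ * ‖u τ x‖ ^ 2) 1 volume :=
      (hu2mem τ hτ).mul' (hDΨmem _ h1s' τ).norm
    refine (memLp_one_iff_integrable.1 h1).mono' ((hmem τ hτ).1.inner
      (aestronglyMeasurable_clm_apply (hDΨcs τ).aestronglyMeasurable (hmem τ hτ).1))
      (Eventually.of_forall fun x => ?_)
    rw [Real.norm_eq_abs]
    calc |⟪u τ x, convect (u τ) (Ψ τ) x⟫| ≤ ‖u τ x‖ ^ 2 * ‖fderiv ℝ (Ψ τ) x‖ := hptN (τ, x)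
      _ = ‖fderiv ℝ (Ψ τ) x‖ * ‖u τ x‖ ^ 2 := by ring
  have hslice : ∀ τ ∈ Ioo 0 S, ∫ x, Fl (τ, x) =
      (deriv η τ * ∫ x, ⟪u τ x, Ψ τ x⟫) + η τ * ∫ x, ⟪u τ x, convect (u τ) (Ψ τ) x⟫ := by
    intro τ hτ
    simp only [hFl, hA, hN]
    rw [integral_add ((iA τ hτ).const_mul _) ((iN τ hτ).const_mul _), integral_const_mul,
      integral_const_mul]
  have hIooS : ∫ τ in Ioo 0 S, ((deriv η τ * ∫ x, ⟪u τ x, Ψ τ x⟫) +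
      η τ * ∫ x, ⟪u τ x, convect (u τ) (Ψ τ) x⟫) = 0 := by
    have e : ∫ τ in Ioo 0 S, ((deriv η τ * ∫ x, ⟪u τ x, Ψ τ x⟫) +
        η τ * ∫ x, ⟪u τ x, convect (u τ) (Ψ τ) x⟫) = ∫ τ in Ioo 0 S, ∫ x, Fl (τ, x) :=
      setIntegral_congr_fun measurableSet_Ioo fun τ hτ => (hslice τ hτ).symm
    rw [e]
    exact hprod
  -- ### (vii) the integrand vanishes off `tsupport η ⊆ (0, t) ⊆ (0, S)`
  have hvan : ∀ τ, τ ∉ tsupport η → ((deriv η τ * ∫ x, ⟪u τ x, Ψ τ x⟫) +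
      η τ * ∫ x, ⟪u τ x, convect (u τ) (Ψ τ) x⟫) = 0 := fun τ hτ => by
    rw [hη0 τ hτ, hdη0 τ hτ]; ring
  have e1 : ∫ τ in Ioo 0 S, ((deriv η τ * ∫ x, ⟪u τ x, Ψ τ x⟫) +
      η τ * ∫ x, ⟪u τ x, convect (u τ) (Ψ τ) x⟫) =
      ∫ τ, ((deriv η τ * ∫ x, ⟪u τ x, Ψ τ x⟫) + η τ * ∫ x, ⟪u τ x, convect (u τ) (Ψ τ) x⟫) :=
    setIntegral_eq_integral_of_forall_compl_eq_zero fun τ hτ =>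
      hvan τ fun h => hτ ⟨(hηt h).1, (hηt h).2.trans htS⟩
  have e2 : ∫ τ in Ioo 0 t, ((deriv η τ * ∫ x, ⟪u τ x, Ψ τ x⟫) +
      η τ * ∫ x, ⟪u τ x, convect (u τ) (Ψ τ) x⟫) =
      ∫ τ, ((deriv η τ * ∫ x, ⟪u τ x, Ψ τ x⟫) + η τ * ∫ x, ⟪u τ x, convect (u τ) (Ψ τ) x⟫) :=
    setIntegral_eq_integral_of_forall_compl_eq_zero fun τ hτ => hvan τ fun h => hτ (hηt h)
  show ∫ τ in Ioo 0 t, ((deriv η τ * ∫ x, ⟪u τ x, Ψ τ x⟫) +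
      η τ * ∫ x, ⟪u τ x, convect (u τ) (Ψ τ) x⟫) = 0
  rw [e2, ← e1, hIooS]

end Core

/-! ### Continuity of the pairing and the main theorem -/

section Main

variable {S ν : ℝ} {u : ℝ → ℝ³ → ℝ³} {φ : ℝ³ → ℝ³}

/-- **Continuity of the caloric pairing, `L^r` version.** For `u ∈ C((0,S); L^r)`, `2 < r`, a test
field `φ`, `0 < ν` and `t < S`, the pairing `g(τ) = ∫⟪u(τ), e^{ν(t−τ)Δ}φ⟫` is continuous on
`(0, t]` from within `(−∞, t]`
(`|g(τ) − g(τ₀)| ≤ ‖u(τ) − u(τ₀)‖_r ‖φ‖_{r'} + ‖u(τ₀)‖_r ‖Ψ(τ) − Ψ(τ₀)‖_{r'}` and the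
`L^{r'}`-Hölder continuity `eLpNorm_heatTest_sub_interpolate_le`, `1 < r' < 2`). [folklore] -/
theorem continuousWithinAt_pairing_heatTest_Lr {t r : ℝ} (hν : 0 < ν) (hr : 2 < r)
    (hφ : FunctionSpaces.IsTestFunctionOn (⊤ : Opens ℝ³) φ)
    (huc : ContinuousInLpOn (Ioo 0 S) (ENNReal.ofReal r) u)
    (htS : t < S) {τ₀ : ℝ} (hτ₀ : τ₀ ∈ Ioc 0 t) :
    ContinuousWithinAt (fun τ => ∫ x, ⟪u τ x, heatTest ν φ (t - τ) x⟫) (Iic t) τ₀ := by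
  have hr1 : 1 < r := by linarith
  set r' : ℝ := Real.conjExponent r with hr'
  have hrr' : r.HolderConjugate r' := Real.HolderConjugate.conjExponent hr1
  have hr'1 : 1 < r' := hrr'.symm.lt
  have hr'0 : 0 < r' := hrr'.symm.pos
  have hr'2 : r' ≤ 2 := conjExponent_le_two hr
  have h1r' : (1 : ℝ≥0∞) ≤ ENNReal.ofReal r' := by
    rw [← ENNReal.ofReal_one]; exact ENNReal.ofReal_le_ofReal hr'1.le
  haveI hRR' : (ENNReal.ofReal r).HolderConjugate (ENNReal.ofReal r') := hrr'.ennrealOfReal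
  have hτ₀S : τ₀ ∈ Ioo 0 S := ⟨hτ₀.1, hτ₀.2.trans_lt htS⟩
  have hφc : HasCompactSupport φ := hφ.hasCompactSupport
  have hφcont : Continuous φ := hφ.contDiff.continuous
  have hφq : MemLp φ (ENNReal.ofReal r') volume := hφcont.memLp_of_hasCompactSupport hφc
  set Ψ : ℝ → ℝ³ → ℝ³ := fun σ => heatTest ν φ (t - σ) with hΨ
  have hΨq : ∀ σ, MemLp (Ψ σ) (ENNReal.ofReal r') volume := fun σ =>
    memLp_heatFlow_of_memLp hφq h1r' _
  have hΨle : ∀ σ, eLpNorm (Ψ σ) (ENNReal.ofReal r') volume ≤ eLpNorm φ (ENNReal.ofReal r') volume :=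
    fun σ => eLpNorm_heatFlow_le_of_memLp hφq h1r' _
  have h3 : ∀ τ ∈ Ioo 0 S, MemLp (u τ) (ENNReal.ofReal r) volume := huc.1
  -- the bound for `τ ∈ (0, S)`, `τ ≤ t`
  set ea : ℝ := (2 - r') / r' with hea
  set eb : ℝ := 2 * (r' - 1) / r' with heb
  have hea0 : 0 ≤ ea := div_nonneg (by linarith) hr'0.le
  have heb0 : 0 < eb := div_pos (by linarith) hr'0
  set K : ℝ≥0∞ := ENNReal.ofReal ν * eLpNorm (Δ φ) 2 volume with hK
  have hKtop : K ≠ ⊤ := ENNReal.mul_ne_top ENNReal.ofReal_ne_top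
    ((FluidPDE.continuous_laplacian (contDiff_infty.1 hφ.contDiff 2)).memLp_of_hasCompactSupport
      (hφc.mono' fun x hx => by
        by_contra h
        exact hx (FluidPDE.laplacian_eq_zero_of_notMem_tsupport h))).2.ne
  set L : ℝ≥0∞ := (2 * eLpNorm φ 1 volume) ^ ea with hL
  have hLtop : L ≠ ⊤ := ENNReal.rpow_ne_top_of_nonneg hea0
    (ENNReal.mul_ne_top ENNReal.ofNat_ne_top (hφcont.memLp_of_hasCompactSupport hφc).2.ne)
  set B : ℝ → ℝ≥0∞ := fun τ =>
    eLpNorm (u τ - u τ₀) (ENNReal.ofReal r) volume * eLpNorm φ (ENNReal.ofReal r') volume +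
      eLpNorm (u τ₀) (ENNReal.ofReal r) volume * (L * (ENNReal.ofReal |τ - τ₀| * K) ^ eb) with hB
  have hdiffq : ∀ τ, τ ≤ t → eLpNorm (Ψ τ - Ψ τ₀) (ENNReal.ofReal r') volume ≤
      L * (ENNReal.ofReal |τ - τ₀| * K) ^ eb := by
    intro τ hτ
    rcases le_total τ τ₀ with h | h
    · have key := eLpNorm_heatTest_sub_interpolate_le hφ hν h hτ₀.2 hr'1.le hr'2 (t := t)
      have e : Ψ τ - Ψ τ₀ = -(heatTest ν φ (t - τ₀) - heatTest ν φ (t - τ)) := by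
        simp only [hΨ, neg_sub]
      rw [e, eLpNorm_neg, abs_of_nonpos (sub_nonpos.2 h), neg_sub]
      exact key
    · have key := eLpNorm_heatTest_sub_interpolate_le hφ hν h hτ hr'1.le hr'2 (t := t)
      rw [abs_of_nonneg (sub_nonneg.2 h)]
      exact key
  have hbound : ∀ τ ∈ Ioo 0 S, τ ≤ t →
      ‖(∫ x, ⟪u τ x, Ψ τ x⟫) - ∫ x, ⟪u τ₀ x, Ψ τ₀ x⟫‖ₑ ≤ B τ := by
    intro τ hτ hτt
    have i1 : Integrable (fun x => ⟪u τ x, Ψ τ x⟫) volume :=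
      integrable_inner_of_memLp_conj (h3 τ hτ) (hΨq τ)
    have i2 : Integrable (fun x => ⟪u τ₀ x, Ψ τ x⟫) volume :=
      integrable_inner_of_memLp_conj (h3 τ₀ hτ₀S) (hΨq τ)
    have i3 : Integrable (fun x => ⟪u τ₀ x, Ψ τ₀ x⟫) volume :=
      integrable_inner_of_memLp_conj (h3 τ₀ hτ₀S) (hΨq τ₀)
    have e : (∫ x, ⟪u τ x, Ψ τ x⟫) - ∫ x, ⟪u τ₀ x, Ψ τ₀ x⟫ =
        (∫ x, ⟪(u τ - u τ₀) x, Ψ τ x⟫) + ∫ x, ⟪u τ₀ x, (Ψ τ - Ψ τ₀) x⟫ := by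
      have s1 : ∫ x, ⟪(u τ - u τ₀) x, Ψ τ x⟫ = (∫ x, ⟪u τ x, Ψ τ x⟫) - ∫ x, ⟪u τ₀ x, Ψ τ x⟫ := by
        rw [← integral_sub i1 i2]
        refine integral_congr_ae (Eventually.of_forall fun x => ?_)
        simp only [Pi.sub_apply, inner_sub_left]
      have s2 : ∫ x, ⟪u τ₀ x, (Ψ τ - Ψ τ₀) x⟫ =
          (∫ x, ⟪u τ₀ x, Ψ τ x⟫) - ∫ x, ⟪u τ₀ x, Ψ τ₀ x⟫ := by
        rw [← integral_sub i2 i3]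
        refine integral_congr_ae (Eventually.of_forall fun x => ?_)
        simp only [Pi.sub_apply, inner_sub_right]
      rw [s1, s2]
      ring
    rw [e]
    have b1 := abs_integral_inner_le_eLpNorm_mul ((h3 τ hτ).sub (h3 τ₀ hτ₀S)) (hΨq τ)
    have b2 := abs_integral_inner_le_eLpNorm_mul (h3 τ₀ hτ₀S) ((hΨq τ).sub (hΨq τ₀))
    have f1 : eLpNorm (u τ - u τ₀) (ENNReal.ofReal r) volume *
        eLpNorm (Ψ τ) (ENNReal.ofReal r') volume ≠ ⊤ :=
      ENNReal.mul_ne_top ((h3 τ hτ).sub (h3 τ₀ hτ₀S)).2.ne (hΨq τ).2.ne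
    have f2 : eLpNorm (u τ₀) (ENNReal.ofReal r) volume *
        eLpNorm (Ψ τ - Ψ τ₀) (ENNReal.ofReal r') volume ≠ ⊤ :=
      ENNReal.mul_ne_top (h3 τ₀ hτ₀S).2.ne ((hΨq τ).sub (hΨq τ₀)).2.ne
    calc ‖(∫ x, ⟪(u τ - u τ₀) x, Ψ τ x⟫) + ∫ x, ⟪u τ₀ x, (Ψ τ - Ψ τ₀) x⟫‖ₑ
        ≤ ‖∫ x, ⟪(u τ - u τ₀) x, Ψ τ x⟫‖ₑ + ‖∫ x, ⟪u τ₀ x, (Ψ τ - Ψ τ₀) x⟫‖ₑ := enorm_add_le _ _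
      _ ≤ eLpNorm (u τ - u τ₀) (ENNReal.ofReal r) volume * eLpNorm (Ψ τ) (ENNReal.ofReal r') volume +
          eLpNorm (u τ₀) (ENNReal.ofReal r) volume *
            eLpNorm (Ψ τ - Ψ τ₀) (ENNReal.ofReal r') volume := by
          refine add_le_add ?_ ?_
          · rw [Real.enorm_eq_ofReal_abs, ← ENNReal.ofReal_toReal f1]
            exact ENNReal.ofReal_le_ofReal b1
          · rw [Real.enorm_eq_ofReal_abs, ← ENNReal.ofReal_toReal f2]
            exact ENNReal.ofReal_le_ofReal b2
      _ ≤ B τ := by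
          rw [hB]
          exact add_le_add (mul_le_mul' le_rfl (hΨle τ)) (mul_le_mul' le_rfl (hdiffq τ hτt))
  -- `B τ → 0` as `τ → τ₀`
  have hB0 : Tendsto B (𝓝 τ₀) (𝓝 0) := by
    have t1 : Tendsto (fun τ => eLpNorm (u τ - u τ₀) (ENNReal.ofReal r) volume) (𝓝 τ₀) (𝓝 0) := by
      have h := huc.2 τ₀ hτ₀S
      rwa [isOpen_Ioo.nhdsWithin_eq hτ₀S] at h
    have t1' : Tendsto (fun τ => eLpNorm (u τ - u τ₀) (ENNReal.ofReal r) volume *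
        eLpNorm φ (ENNReal.ofReal r') volume) (𝓝 τ₀) (𝓝 0) := by
      have := ENNReal.Tendsto.mul_const t1 (Or.inr hφq.2.ne)
      rwa [zero_mul] at this
    have t2 : Tendsto (fun τ : ℝ => ENNReal.ofReal |τ - τ₀|) (𝓝 τ₀) (𝓝 0) := by
      have h : Tendsto (fun τ : ℝ => |τ - τ₀|) (𝓝 τ₀) (𝓝 0) := by
        have := ((continuous_id.sub continuous_const).abs.tendsto τ₀ : Tendsto
          (fun τ : ℝ => |τ - τ₀|) (𝓝 τ₀) (𝓝 |τ₀ - τ₀|))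
        simpa using this
      have h' := (ENNReal.continuous_ofReal.tendsto 0).comp h
      rw [ENNReal.ofReal_zero] at h'
      exact h'
    have t3 : Tendsto (fun τ : ℝ => (ENNReal.ofReal |τ - τ₀| * K) ^ eb) (𝓝 τ₀) (𝓝 0) := by
      have h1 : Tendsto (fun τ : ℝ => ENNReal.ofReal |τ - τ₀| * K) (𝓝 τ₀) (𝓝 0) := by
        have := ENNReal.Tendsto.mul_const t2 (Or.inr hKtop)
        rwa [zero_mul] at this
      have h2 := ((ENNReal.continuous_rpow_const (y := eb)).tendsto 0).comp h1
      rwa [ENNReal.zero_rpow_of_pos heb0] at h2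
    have t4 : Tendsto (fun τ : ℝ => eLpNorm (u τ₀) (ENNReal.ofReal r) volume *
        (L * (ENNReal.ofReal |τ - τ₀| * K) ^ eb)) (𝓝 τ₀) (𝓝 0) := by
      have h1 := ENNReal.Tendsto.const_mul t3 (Or.inr hLtop)
      rw [mul_zero] at h1
      have h2 := ENNReal.Tendsto.const_mul h1 (Or.inr (h3 τ₀ hτ₀S).2.ne)
      rwa [mul_zero] at h2
    have := t1'.add t4
    rwa [add_zero] at this
  -- squeeze
  have hev : ∀ᶠ τ in 𝓝[Iic t] τ₀, ‖(∫ x, ⟪u τ x, Ψ τ x⟫) - ∫ x, ⟪u τ₀ x, Ψ τ₀ x⟫‖ₑ ≤ B τ := by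
    have hmem : Ioo 0 S ∈ 𝓝[Iic t] τ₀ := mem_nhdsWithin_of_mem_nhds (isOpen_Ioo.mem_nhds hτ₀S)
    filter_upwards [hmem, self_mem_nhdsWithin] with τ hτ hτt
    exact hbound τ hτ hτt
  have hen : Tendsto (fun τ => ‖(∫ x, ⟪u τ x, Ψ τ x⟫) - ∫ x, ⟪u τ₀ x, Ψ τ₀ x⟫‖ₑ) (𝓝[Iic t] τ₀)
      (𝓝 0) :=
    tendsto_of_tendsto_of_tendsto_of_le_of_le' tendsto_const_nhds (hB0.mono_left nhdsWithin_le_nhds)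
      (Eventually.of_forall fun τ => bot_le) hev
  have hreal : Tendsto (fun τ => ‖(∫ x, ⟪u τ x, Ψ τ x⟫) - ∫ x, ⟪u τ₀ x, Ψ τ₀ x⟫‖) (𝓝[Iic t] τ₀)
      (𝓝 0) := by
    have h := (ENNReal.tendsto_toReal ENNReal.zero_ne_top).comp hen
    rw [ENNReal.toReal_zero] at h
    refine h.congr fun τ => ?_
    simp only [Function.comp_apply, toReal_enorm]
  exact tendsto_iff_norm_sub_tendsto_zero.2 hreal

set_option maxHeartbeats 1600000 in
/-- **Very weak solutions with continuous `L^q` slices, `q > 2`, are mild solutions**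
(Fabes–Jones–Rivière 1972, Thm. 2.1, (i) ⇒ (ii); Lemarié-Rieusset 2016, Prop. 6.5 with Thm. 6.1:
very weak solutions are Oseen solutions — here with NO pressure hypothesis). Let `2 < r`, `0 < ν`,
and let `u` be jointly measurable on the open slab `(0, S) × ℝ³`, with `u ∈ C((0,S); L^r)`,
`‖u(τ)‖_{L^r} ≤ M` on `(0, S)`, weakly divergence-free slices, and a very weak solution of the
unforced Navier–Stokes system: `∫∫ ⟪u, ∂ₜχ⟫ + ⟪u, (u·∇)χ⟫ + ν⟪u, Δχ⟫ = 0` for every divergence-free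
test field `χ` on the slab. Then for all `0 < s ≤ t < S` the two-time duality identity
`∫⟪u(t), φ⟫ = ∫⟪u(s), e^{ν(t−s)Δ}φ⟫ + ∫ₛᵗ ∫⟪u, (u·∇)e^{ν(t−τ)Δ}φ⟫ dτ` holds for every smooth
compactly supported divergence-free `φ` (`IsMildNSSolutionBetween ν 0 u s t`). Proof: the tested
identity `integral_deriv_mul_pairing_add_eq_zero_veryWeak`, the du Bois-Reymond lemma
`exists_ae_eq_const_add_primitive`, and the continuity of the pairing
(`continuousWithinAt_pairing_heatTest_Lr`). [cite: FabesJonesRiviere1972, Thm. 2.1; LemarieRieusset2016, Prop. 6.5] -/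
theorem isMildNSSolutionBetween_of_veryWeak {r : ℝ} {M : ℝ≥0} (hν : 0 < ν) (hr : 2 < r)
    (hum : AEStronglyMeasurable (uncurry u) (volume.restrict (Ioo 0 S ×ˢ (univ : Set ℝ³))))
    (huc : ContinuousInLpOn (Ioo 0 S) (ENNReal.ofReal r) u)
    (huM : ∀ τ ∈ Ioo 0 S, eLpNorm (u τ) (ENNReal.ofReal r) volume ≤ M)
    (hdiv : ∀ τ ∈ Ioo 0 S, IsWeaklyDivFree (u τ))
    (hweak : ∀ χ : ℝ → ℝ³ → ℝ³, IsSpaceTimeTestOn (slab ℝ³ (Ioo 0 S) isOpen_Ioo) χ →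
      (∀ t, VectorCalculus.IsDivFree (χ t)) →
      ∫ z in Ioo 0 S ×ˢ (univ : Set ℝ³), veryWeakIntegrand ν u χ z = 0)
    {s t : ℝ} (hs : 0 < s) (hst : s ≤ t) (htS : t < S) :
    IsMildNSSolutionBetween ν 0 u s t := by
  rcases hst.eq_or_lt with h | hst'
  · subst h; exact IsMildNSSolutionBetween.refl ν 0 u s
  intro φ hφ hdivφ
  have ht : 0 < t := hs.trans hst'
  have hS : 0 < S := ht.trans htS
  have hmem : ∀ τ ∈ Ioo 0 S, MemLp (u τ) (ENNReal.ofReal r) volume := huc.1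
  -- exponents
  have hr1 : 1 < r := by linarith
  have hr0 : 0 < r := by linarith
  set r' : ℝ := Real.conjExponent r with hr'
  have hrr' : r.HolderConjugate r' := Real.HolderConjugate.conjExponent hr1
  have hr'1 : 1 < r' := hrr'.symm.lt
  set s₂ : ℝ := r / 2 with hs₂
  have hs₂1 : 1 < s₂ := by rw [hs₂]; linarith
  set s' : ℝ := Real.conjExponent s₂ with hs'
  have hss' : s₂.HolderConjugate s' := Real.HolderConjugate.conjExponent hs₂1
  have hs'1 : 1 < s' := hss'.symm.lt
  have h1r : (1 : ℝ≥0∞) ≤ ENNReal.ofReal r := by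
    rw [← ENNReal.ofReal_one]; exact ENNReal.ofReal_le_ofReal hr1.le
  have h1r' : (1 : ℝ≥0∞) ≤ ENNReal.ofReal r' := by
    rw [← ENNReal.ofReal_one]; exact ENNReal.ofReal_le_ofReal hr'1.le
  have h1s' : (1 : ℝ≥0∞) ≤ ENNReal.ofReal s' := by
    rw [← ENNReal.ofReal_one]; exact ENNReal.ofReal_le_ofReal hs'1.le
  haveI hRR' : (ENNReal.ofReal r).HolderConjugate (ENNReal.ofReal r') := hrr'.ennrealOfReal
  haveI hSS' : (ENNReal.ofReal s₂).HolderConjugate (ENNReal.ofReal s') := hss'.ennrealOfReal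
  -- the test field
  have hφi : ContDiff ℝ ∞ φ := hφ.contDiff
  have hφ2 : ContDiff ℝ 2 φ := contDiff_infty.1 hφi 2
  have hφ1 : ContDiff ℝ 1 φ := contDiff_infty.1 hφi 1
  have hφc : HasCompactSupport φ := hφ.hasCompactSupport
  have hφc' : Continuous φ := hφi.continuous
  obtain ⟨Cφ, hCφ⟩ := hφc'.bounded_above_of_compact_support hφc
  have hDφc : Continuous (fderiv ℝ φ) := hφ1.continuous_fderiv one_ne_zero
  have hDφs : HasCompactSupport (fderiv ℝ φ) := hφc.fderiv ℝ
  obtain ⟨CD, hCD⟩ := hDφc.bounded_above_of_compact_support hDφs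
  have hφp : ∀ p : ℝ≥0∞, MemLp φ p volume := fun p => hφc'.memLp_of_hasCompactSupport hφc
  have hDφp : ∀ p : ℝ≥0∞, MemLp (fderiv ℝ φ) p volume := fun p =>
    hDφc.memLp_of_hasCompactSupport hDφs
  set Ψ : ℝ → ℝ³ → ℝ³ := fun τ => heatTest ν φ (t - τ) with hΨ
  have hΨsm : ∀ τ, ContDiff ℝ 2 (Ψ τ) := fun τ => contDiff_heatFlow hφ2 hφc _
  have hΨcs : ∀ τ, Continuous (Ψ τ) := fun τ => (hΨsm τ).continuous
  have hDΨ : ∀ τ x, fderiv ℝ (Ψ τ) x = heatFlow (fderiv ℝ φ) (ν * (t - τ)) x := fun τ x =>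
    fderiv_heatFlow hφ1 hφc _ x
  have hΨc : Continuous (uncurry Ψ) := continuous_uncurry_heatTest_sub hφc' hCφ ν t
  have hDΨc : Continuous fun q : ℝ × ℝ³ => fderiv ℝ (Ψ q.1) q.2 := by
    simp only [hDΨ]
    exact continuous_uncurry_heatTest_sub hDφc hCD ν t
  have hDΨcs : ∀ τ, Continuous fun x => fderiv ℝ (Ψ τ) x := fun τ =>
    hDΨc.comp (Continuous.prodMk_right τ)
  have hΨmem : ∀ τ, MemLp (Ψ τ) (ENNReal.ofReal r') volume := fun τ =>
    memLp_heatFlow_of_memLp (hφp _) h1r' _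
  have hΨle : ∀ τ, eLpNorm (Ψ τ) (ENNReal.ofReal r') volume ≤ eLpNorm φ (ENNReal.ofReal r') volume :=
    fun τ => eLpNorm_heatFlow_le_of_memLp (hφp _) h1r' _
  have hDΨmem : ∀ τ, MemLp (fun x => fderiv ℝ (Ψ τ) x) (ENNReal.ofReal s') volume := by
    intro τ
    have h := memLp_heatFlow_of_memLp_general (hDφp _) h1s' (ν * (t - τ))
    refine h.congr_norm (hDΨcs τ).aestronglyMeasurable (Eventually.of_forall fun x => ?_)
    rw [hDΨ]
  have hDΨle : ∀ τ, eLpNorm (fun x => fderiv ℝ (Ψ τ) x) (ENNReal.ofReal s') volume ≤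
      eLpNorm (fderiv ℝ φ) (ENNReal.ofReal s') volume := by
    intro τ
    have h := eLpNorm_heatFlow_le_of_memLp_general (hDφp _) h1s' (ν * (t - τ))
    refine le_trans (le_of_eq (eLpNorm_congr_ae (Eventually.of_forall fun x => ?_))) h
    exact hDΨ τ x
  -- the two slice functionals
  set g : ℝ → ℝ := fun τ => ∫ x, ⟪u τ x, Ψ τ x⟫ with hg
  set Nf : ℝ → ℝ := fun τ => ∫ x, ⟪u τ x, convect (u τ) (Ψ τ) x⟫ with hNf
  -- ### bounds and measurability of `g`, `Nf` on `(0, S)`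
  set Bg : ℝ := ((M : ℝ≥0∞) * eLpNorm φ (ENNReal.ofReal r') volume).toReal with hBg
  have hgb : ∀ τ ∈ Ioo 0 S, ‖g τ‖ ≤ Bg := by
    intro τ hτ
    rw [Real.norm_eq_abs]
    have b1 := abs_integral_inner_le_eLpNorm_mul (hmem τ hτ) (hΨmem τ)
    refine b1.trans (ENNReal.toReal_mono (ENNReal.mul_ne_top ENNReal.coe_ne_top (hφp _).2.ne) ?_)
    exact mul_le_mul' (huM τ hτ) (hΨle τ)
  have hu2mem : ∀ τ ∈ Ioo 0 S, MemLp (fun x => ‖u τ x‖ ^ 2) (ENNReal.ofReal s₂) volume := by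
    intro τ hτ
    have h := (hmem τ hτ).norm_rpow_div (2 : ℝ≥0∞)
    have e1 : ENNReal.ofReal r / 2 = ENNReal.ofReal s₂ := by
      rw [hs₂, ENNReal.ofReal_div_of_pos two_pos, ENNReal.ofReal_ofNat]
    rw [e1] at h
    refine h.congr_norm ((hmem τ hτ).1.norm.pow 2) (Eventually.of_forall fun x => ?_)
    simp only [ENNReal.toReal_ofNat, Real.rpow_two, norm_pow, norm_norm]
  set BN : ℝ := (eLpNorm (fderiv ℝ φ) (ENNReal.ofReal s') volume).toReal * ((M : ℝ) ^ r) ^ (2 / r)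
    with hBN
  have hNb : ∀ τ ∈ Ioo 0 S, ‖Nf τ‖ ≤ BN := by
    intro τ hτ
    have iprod : Integrable (fun x => ‖fderiv ℝ (Ψ τ) x‖ * ‖u τ x‖ ^ 2) volume :=
      memLp_one_iff_integrable.1 ((hu2mem τ hτ).mul' (hDΨmem τ).norm)
    rw [Real.norm_eq_abs]
    calc |Nf τ| ≤ ∫ x, ‖⟪u τ x, convect (u τ) (Ψ τ) x⟫‖ := by
          rw [hNf, ← Real.norm_eq_abs]; exact norm_integral_le_integral_norm _
      _ ≤ ∫ x, ‖fderiv ℝ (Ψ τ) x‖ * ‖u τ x‖ ^ 2 := by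
          refine integral_mono_of_nonneg (Eventually.of_forall fun x => norm_nonneg _) iprod
            (Eventually.of_forall fun x => ?_)
          dsimp only
          rw [Real.norm_eq_abs]
          calc |⟪u τ x, convect (u τ) (Ψ τ) x⟫| ≤ ‖u τ x‖ * ‖fderiv ℝ (Ψ τ) x (u τ x)‖ :=
                abs_real_inner_le_norm _ _
            _ ≤ ‖u τ x‖ * (‖fderiv ℝ (Ψ τ) x‖ * ‖u τ x‖) :=
                mul_le_mul_of_nonneg_left (ContinuousLinearMap.le_opNorm _ _) (norm_nonneg _)
            _ = ‖fderiv ℝ (Ψ τ) x‖ * ‖u τ x‖ ^ 2 := by ring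
      _ ≤ (eLpNorm (fun x => fderiv ℝ (Ψ τ) x) (ENNReal.ofReal s') volume).toReal *
            (∫ x, ‖u τ x‖ ^ r) ^ (2 / r) := integral_norm_mul_norm_sq_le hr (hDΨmem τ) (hmem τ hτ)
      _ ≤ BN := by
          rw [hBN]
          refine mul_le_mul (ENNReal.toReal_mono (hDφp _).2.ne (hDΨle τ)) ?_
            (Real.rpow_nonneg (integral_nonneg fun x => by positivity) _) ENNReal.toReal_nonneg
          exact Real.rpow_le_rpow (integral_nonneg fun x => by positivity)
            (integral_norm_rpow_le hr0 (hmem τ hτ) (huM τ hτ)) (by positivity)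
  -- measurability through the slab
  have hum' : AEStronglyMeasurable (fun z : ℝ × ℝ³ => u z.1 z.2)
      ((volume.restrict (Ioo 0 S)).prod (volume : Measure ℝ³)) := by
    have h : AEStronglyMeasurable (fun z : ℝ × ℝ³ => u z.1 z.2)
        (volume.restrict (Ioo 0 S ×ˢ (univ : Set ℝ³))) := hum
    rwa [volume_restrict_prod_univ_eq_prod] at h
  have hgm : AEStronglyMeasurable g (volume.restrict (Ioo 0 S)) := by
    have hA : AEStronglyMeasurable (fun z : ℝ × ℝ³ => ⟪u z.1 z.2, Ψ z.1 z.2⟫)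
        ((volume.restrict (Ioo 0 S)).prod (volume : Measure ℝ³)) := hum'.inner hΨc.aestronglyMeasurable
    exact hA.integral_prod_right'
  have hNm : AEStronglyMeasurable Nf (volume.restrict (Ioo 0 S)) := by
    have hA : AEStronglyMeasurable (fun z : ℝ × ℝ³ => ⟪u z.1 z.2, convect (u z.1) (Ψ z.1) z.2⟫)
        ((volume.restrict (Ioo 0 S)).prod (volume : Measure ℝ³)) :=
      hum'.inner (aestronglyMeasurable_clm_apply hDΨc.aestronglyMeasurable hum')
    exact hA.integral_prod_right'
  have hsub : Ioo 0 t ⊆ Ioo 0 S := Ioo_subset_Ioo le_rfl htS.le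
  have hvol_t : volume (Ioo (0 : ℝ) t) < ⊤ := by rw [Real.volume_Ioo]; exact ENNReal.ofReal_lt_top
  have hgi : IntegrableOn g (Ioo 0 t) := by
    refine IntegrableOn.of_bound hvol_t (hgm.mono_measure (Measure.restrict_mono hsub le_rfl)) Bg ?_
    filter_upwards [ae_restrict_mem measurableSet_Ioo] with τ hτ
    exact hgb τ (hsub hτ)
  have hNi : IntegrableOn Nf (Ioo 0 t) := by
    refine IntegrableOn.of_bound hvol_t (hNm.mono_measure (Measure.restrict_mono hsub le_rfl)) BN ?_
    filter_upwards [ae_restrict_mem measurableSet_Ioo] with τ hτ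
    exact hNb τ (hsub hτ)
  -- weak divergence-freeness on the slab from the slices
  have hu1 : LocallyIntegrableOn (uncurry u)
      ((slab ℝ³ (Ioo 0 S) isOpen_Ioo : Opens (ℝ × ℝ³)) : Set (ℝ × ℝ³)) volume := by
    have hur_slice : ∀ τ ∈ Ioo 0 S, ∫⁻ x, ‖u τ x‖ₑ ^ r ≤ (M : ℝ≥0∞) ^ r := by
      intro τ hτ
      rw [lintegral_rpow_enorm_eq (u τ) hr0]
      exact ENNReal.rpow_le_rpow (huM τ hτ) hr0.le
    have hmeas : AEMeasurable (fun z : ℝ × ℝ³ => ‖u z.1 z.2‖ₑ ^ r)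
        ((volume.restrict (Ioo 0 S)).prod (volume : Measure ℝ³)) := hum'.enorm.pow_const _
    have hur : ∫⁻ z in Ioo 0 S ×ˢ (univ : Set ℝ³), ‖u z.1 z.2‖ₑ ^ r < ⊤ := by
      rw [volume_restrict_prod_univ_eq_prod, lintegral_prod _ hmeas]
      calc ∫⁻ τ in Ioo 0 S, ∫⁻ x, ‖u τ x‖ₑ ^ r
          ≤ ∫⁻ _ in Ioo 0 S, (M : ℝ≥0∞) ^ r := by
            refine lintegral_mono_ae ?_
            filter_upwards [ae_restrict_mem measurableSet_Ioo] with τ hτ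
            exact hur_slice τ hτ
        _ < ⊤ := by
            rw [lintegral_const, Measure.restrict_apply_univ, Real.volume_Ioo]
            exact ENNReal.mul_lt_top (ENNReal.rpow_lt_top_of_nonneg hr0.le ENNReal.coe_ne_top)
              ENNReal.ofReal_lt_top
    have huLr : MemLp (uncurry u) (ENNReal.ofReal r) (volume.restrict (Ioo 0 S ×ˢ (univ : Set ℝ³))) := by
      refine ⟨hum, ?_⟩
      rw [eLpNorm_eq_lintegral_rpow_enorm_toReal (ENNReal.ofReal_pos.2 hr0).ne' ENNReal.ofReal_ne_top,
        ENNReal.toReal_ofReal hr0.le]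
      exact ENNReal.rpow_lt_top_of_nonneg (by positivity) hur.ne
    exact locallyIntegrableOn_slab_of_memLp huLr h1r
  have hdivsl : ∀ θ : ℝ → ℝ³ → ℝ, IsSpaceTimeTestOn (slab ℝ³ (Ioo 0 S) isOpen_Ioo) θ →
      ∫ z in Ioo 0 S ×ˢ (univ : Set ℝ³), ⟪u z.1 z.2, gradient (θ z.1) z.2⟫ = 0 := by
    intro θ hθ
    obtain ⟨hwc, -, hw0⟩ := hθ.continuous_gradient_field
    have hKQ : tsupport (uncurry θ) ⊆ ((slab ℝ³ (Ioo 0 S) isOpen_Ioo : Opens (ℝ × ℝ³)) : Set (ℝ × ℝ³)) :=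
      hθ.tsupport_subset
    have hI : Integrable (fun ζ : ℝ × ℝ³ => ⟪u ζ.1 ζ.2, gradient (θ ζ.1) ζ.2⟫)
        (volume : Measure (ℝ × ℝ³)) :=
      integrable_inner_of_locallyIntegrableOn (Q := slab ℝ³ (Ioo 0 S) isOpen_Ioo)
        hu1 hwc hθ.hasCompactSupport hKQ hw0
    have hvan : ∀ ζ : ℝ × ℝ³, ζ ∉ Ioo 0 S ×ˢ (univ : Set ℝ³) →
        ⟪u ζ.1 ζ.2, gradient (θ ζ.1) ζ.2⟫ = 0 := fun ζ hζ => by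
      rw [hw0 ζ fun h => hζ (hKQ h), inner_zero_right]
    rw [setIntegral_eq_integral_of_forall_compl_eq_zero hvan,
      show (volume : Measure (ℝ × ℝ³)) = (volume : Measure ℝ).prod (volume : Measure ℝ³) from rfl,
      integral_prod _ hI]
    have hslice : ∀ τ, ∫ x, ⟪u τ x, gradient (θ τ) x⟫ = 0 := by
      intro τ
      by_cases hτ : τ ∈ Ioo 0 S
      · exact hdiv τ hτ (θ τ) ((hθ.mono le_top).isTestFunctionOn_slice τ)
      · refine integral_eq_zero_of_ae (Eventually.of_forall fun x => ?_)
        have hζ : ((τ, x) : ℝ × ℝ³) ∉ tsupport (uncurry θ) := fun h => hτ (mem_slab.1 (hKQ h))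
        simp only [hw0 (τ, x) hζ, inner_zero_right, Pi.zero_apply]
    simp only [hslice, integral_zero]
  -- ### du Bois-Reymond
  obtain ⟨c, hc⟩ := exists_ae_eq_const_add_primitive hgi hNi fun χ hχ hχc hχt =>
    integral_deriv_mul_pairing_add_eq_zero_veryWeak hν hr hum hmem huM hdivsl hweak hφ hdivφ ht htS
      hχ hχc hχt
  set G : ℝ → ℝ := fun τ => c + ∫ σ in Ioc 0 τ, Nf σ with hG
  have hNi' : IntegrableOn Nf (Icc 0 t) :=
    (integrableOn_Icc_iff_integrableOn_Ioo (by simp) (by simp)).2 hNi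
  have hGc : ContinuousOn G (Icc 0 t) :=
    continuousOn_const.add (intervalIntegral.continuousOn_primitive hNi')
  -- continuity of `g` on `(0, t]`
  have hgc : ∀ τ₀ ∈ Ioc 0 t, ContinuousWithinAt g (Iic t) τ₀ := fun τ₀ hτ₀ =>
    continuousWithinAt_pairing_heatTest_Lr hν hr hφ huc htS hτ₀
  have hgc' : ContinuousOn g (Ioo 0 t) := fun τ₀ hτ₀ =>
    (hgc τ₀ ⟨hτ₀.1, hτ₀.2.le⟩).mono fun x hx => le_of_lt hx.2
  -- `g = G` on `(0, t)`
  have heq : EqOn g G (Ioo 0 t) :=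
    Measure.eqOn_open_of_ae_eq hc isOpen_Ioo hgc' (hGc.mono Ioo_subset_Icc_self)
  -- and at `t`, by continuity from the left
  haveI : (𝓝[Ioo 0 t] t).NeBot := right_nhdsWithin_Ioo_neBot ht
  have hgt : g t = G t := by
    have h1 : Tendsto g (𝓝[Ioo 0 t] t) (𝓝 (g t)) :=
      (hgc t ⟨ht, le_rfl⟩).mono_left (nhdsWithin_mono _ fun x hx => le_of_lt hx.2)
    have h2 : Tendsto G (𝓝[Ioo 0 t] t) (𝓝 (G t)) :=
      (hGc t ⟨ht.le, le_rfl⟩).mono_left (nhdsWithin_mono _ Ioo_subset_Icc_self)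
    have h3' : Tendsto g (𝓝[Ioo 0 t] t) (𝓝 (G t)) :=
      h2.congr' (eventually_nhdsWithin_of_forall fun τ hτ => (heq hτ).symm)
    exact tendsto_nhds_unique h1 h3'
  have hgs : g s = G s := heq ⟨hs, hst'⟩
  -- ### the identity
  have hNint : IntervalIntegrable Nf volume 0 t :=
    (intervalIntegrable_iff_integrableOn_Icc_of_le ht.le).2 hNi'
  have hNint_s : IntervalIntegrable Nf volume 0 s :=
    hNint.mono_set (by rw [uIcc_of_le hs.le, uIcc_of_le ht.le]; exact Icc_subset_Icc le_rfl hst)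
  have hdiff : g t - g s = ∫ τ in s..t, Nf τ := by
    rw [hgt, hgs, hG]
    dsimp only
    rw [← intervalIntegral.integral_of_le ht.le, ← intervalIntegral.integral_of_le hs.le,
      add_sub_add_left_eq_sub, intervalIntegral.integral_interval_sub_left hNint hNint_s]
  have hgt' : g t = ∫ x, ⟪u t x, φ x⟫ := by
    simp only [hg, hΨ, sub_self, heatTest_zero_right]
  have hgs' : g s = ∫ x, ⟪u s x, heatTest ν φ (t - s) x⟫ := rfl
  show ∫ x, ⟪u t x, φ x⟫ = (∫ x, ⟪u s x, heatTest ν φ (t - s) x⟫) +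
    (∫ τ in s..t, ∫ x, ⟪u τ x, convect (u τ) (heatTest ν φ (t - τ)) x⟫) +
    ∫ τ in s..t, ∫ x, ⟪(0 : ℝ → ℝ³ → ℝ³) τ x, heatTest ν φ (t - τ) x⟫
  simp only [Pi.zero_apply, inner_zero_left, integral_zero, intervalIntegral.integral_zero, add_zero]
  rw [← hgt', ← hgs']
  have : (∫ τ in s..t, ∫ x, ⟪u τ x, convect (u τ) (heatTest ν φ (t - τ)) x⟫) = ∫ τ in s..t, Nf τ := rfl
  rw [this, ← hdiff]
  ring

/-- **The translate of a very weak `C_t L^q` solution is a mild solution from its slice**: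
under the hypotheses of `isMildNSSolutionBetween_of_veryWeak`, for `s ∈ (0, S)` the field
`σ ↦ u(σ + s)` is a mild solution on `[0, S − s)` with datum `u(s)` in the accepted duality form
(`IsMildNSSolutionOn (Ico 0 (S − s)) ν 0 (u s) (fun σ => u (σ + s))`). [cite: FabesJonesRiviere1972, Thm. 2.1] -/
theorem isMildNSSolutionOn_translate_of_veryWeak {r : ℝ} {M : ℝ≥0} (hν : 0 < ν) (hr : 2 < r)
    (hum : AEStronglyMeasurable (uncurry u) (volume.restrict (Ioo 0 S ×ˢ (univ : Set ℝ³))))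
    (huc : ContinuousInLpOn (Ioo 0 S) (ENNReal.ofReal r) u)
    (huM : ∀ τ ∈ Ioo 0 S, eLpNorm (u τ) (ENNReal.ofReal r) volume ≤ M)
    (hdiv : ∀ τ ∈ Ioo 0 S, IsWeaklyDivFree (u τ))
    (hweak : ∀ χ : ℝ → ℝ³ → ℝ³, IsSpaceTimeTestOn (slab ℝ³ (Ioo 0 S) isOpen_Ioo) χ →
      (∀ t, VectorCalculus.IsDivFree (χ t)) →
      ∫ z in Ioo 0 S ×ˢ (univ : Set ℝ³), veryWeakIntegrand ν u χ z = 0)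
    {s : ℝ} (hs : s ∈ Ioo 0 S) :
    IsMildNSSolutionOn (Ico 0 (S - s)) ν 0 (u s) (fun σ => u (σ + s)) := by
  refine ⟨fun σ hσ => hdiv (σ + s) ⟨by linarith [hσ.1, hs.1], by linarith [hσ.2]⟩,
    fun σ hσ => ?_⟩
  have hb' : IsMildNSSolutionBetween ν 0 u s (σ + s) :=
    isMildNSSolutionBetween_of_veryWeak hν hr hum huc huM hdiv hweak hs.1 (by linarith [hσ.1])
      (by linarith [hσ.2])
  have hb : IsMildNSSolutionBetween ν 0 u (0 + s) (σ + s) := by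
    simp only [zero_add]
    exact hb'
  have h2 : IsMildNSSolutionBetween ν 0 (fun τ => u (τ + s)) 0 σ :=
    IsMildNSSolutionBetween.comp_add_right_zero hb
  have h3 : IsMildNSSolutionFrom ν 0 ((fun τ => u (τ + s)) 0) (fun τ => u (τ + s)) σ :=
    isMildNSSolutionFrom_self_iff.2 h2
  simpa only [zero_add] using h3

end Main

end VeryWeakLqMild

end Literature.Analysis.FluidPDE

end
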